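import Literature.MathematicalPhysics.QuantumFieldTheory.Balaban1983to89.Beta.SecondOrderResponse
import Literature.MathematicalPhysics.QuantumFieldTheory.Balaban1983to89.Beta.WilsonBiStencil

/-!
# `Balaban1983to89.Beta.BalabanStepW2` — Bałaban's step jets WITH their second-order family: the Lagrangian-chart tables
# `Spure` / `M1`, the family `Wbal j := W2SymOfK (KInvStep Lc j) Lc (Spure j) (M1 j) (T₂ j) (M₂ j)` over the two remaining table
# binders, and the instantiated dressed family `JsBalW2` with its sockets — Stage A, v1; + Stage B, v1.1: the second response-derivative
# of a packed resolvent `K3OfK`, the step-form value 4-jet `e4OfW`, the RECURSIVE bi-stencil family `T2Of` and the instantiated family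
# `JsBalT2Of` (β sub-cell, an2 lineage, work-order (P4))

HONEST LABEL (cell charter): bookkeeping for the β-function audit of Bałaban's renormalization-group construction; «discharging
`BetaPertH` makes Balaban's UV stability UNCONDITIONAL — a real constructive-QFT result; it is NOT the continuum limit and NOT the Clay
problem».  This file is construction/bookkeeping only: it discharges nothing of `FlowStep.BetaPertH`; NOT summit progress, NOT continuum,
NOT Clay.

ABSOLUTE RULE (cell charter, verbatim): «No internally-minted statement may enter as a cited fact. Every hypothesis is either
kernel-proved in this package or a verbatim quotation of a PUBLISHED theorem with page reference. The manuscript(s) under audit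
are NOT citable for their own disputed steps — they are the thing under adjudication; programme-internal (2001/route/tribunal)
claims are never citable.»  Accordingly NO declaration below is a `def … : Prop` carrying a citation and no hypothesis of any
theorem is a located manuscript step: everything is [folklore] — definitions, or proved here from the imports.

WHAT THIS FILE IS FOR.  The wall statement `OneStepKernelFamily.D1Drift Lc (BalabanStepJetsSucc.JsBalOf hLc cE cVH cΛ W Cw δw hδw hW) N μ ν`
carries the second-order background family `W : ℕ → …` of Bałaban's step jets as an HONEST BINDER.  `Beta/SecondOrderResponse` built
the generic CARRIER `W2SymOfK K N S M S₂ M₂` (the Lagrangian-chart chain rule at order two through an arbitrary packed resolvent `K`,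
swap-symmetrised) with its `loc₂` and (Wt) sockets.  This leaf INSTANTIATES the carrier at every step `j` with the two first-order
tables the lineage already owns and leaves exactly the two genuinely second-order fine tables as binders:
* `K := OneStepKernelFamily.KInvStep Lc j` (an4's decimated composite resolvent — the kernel `TstepOf Lc j` reads the first-order
  vertex through);
* `S := Spure j` (§1) — the UNFOLDED first field stencil: `BalabanStepJets.S0` / `BalabanStepJetsSucc.Sstep (j+1)` WITHOUT their
  Lagrange piece `cΛ • SLam …` (member `0`: `cE • wilsonA + cVH • mfNeg vhS`; member `j+1`: `(cE·wE) • e3Of (j+1) + (cVH·wVH) •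
  mfNeg vhS`), i.e. the (V-Δ)/`E‴` and (V-H) pieces = the partial `U`-derivative table of the bordered operator;
* `M := M1 j` (§1) — the partial MULTIPLIER-derivative table `ρ w ↦ (cΛ·wM1 j) • hessFF Lc ρ w` (an1's constraint Hessian `Q″_{(ρ,w)}(1)`;
  weight `wM1 j = (Lc^j)^{2(d+2)}`, NO new colour constant — see THE ORDER-ONE CONSISTENCY READING below);
* `S₂ := T₂ j` — BINDER: a family of fine BI-stencil tables (`BalabanCompositeJets.LocStencil₂` shape; Bałaban's: the Wilson / value-function
  FOURTH jets plus the second averaging jets through `mfNeg` — Stage B of this leaf and an1's node 12b, NOT here);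
* `M₂ := M2Of mixFF j := (wM2 j) • mixFF` — BINDER: ONE fine field–multiplier table `mixFF κ u ρ w` (`SecondOrderResponse.LocStencilFM`
  shape; Bałaban's: one background leg on an1's fluctuation–fluctuation averaging Hessian at the coarse bond — an1's node 12b, NOT here),
  weight `wM2 j = (Lc^j)^{3(d+2)}`.
The result is `WbalOf cE cVH cΛ T₂ mixFF j` (§2) with `vertexFamily₂_WbalOf'` (the `loc₂` socket: SOME positive rate, from
`SecondOrderResponse.vertexFamily₂_W2SymOfK'` and an4's `decays_KInvStep`), its swap symmetry `WbalOf_swap` (β-lead binder item (w1)), the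
`Classical.choose`-packaged constants `CwOf` / `δwOf` / `δwOf_pos` / `WbalOf_loc₂`, and THE INSTANTIATED DRESSED FAMILY
`JsBalW2Of hLc cE cVH cΛ T₂ mixFF hT₂ hmix := BalabanStepJetsSucc.JsBalOf hLc cE cVH cΛ (WbalOf …) (CwOf …) (δwOf …) (δwOf_pos …) (WbalOf_loc₂ …)`
(`JsBalW2Of_apply`, `rfl` — so EVERY socket lemma of `OneStepKernelFamily` / `StepJetData` / `AxialDressing` / `BalabanStepJetsSucc` applies
to it BY NAME).  §3 supplies the sockets of the instantiated family: (Wt) `WbalOf_translate` (from `SecondOrderResponse.W2SymOfK_translate`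
fed with an4's `shiftK_KInvStep`, `Spure_translate`, `M1_translate`, and the JOINT block covariance of the two binder tables in the byte
shapes `hT₂t` / `hmixt` below), `JsBalW2Of_S_translate` / `JsBalW2Of_W_translate` ((St♭)/(Wt) of the dressed family,
`BalabanStepJetsSucc.JsBalOf_S_translate` / `JsBalOf_W_translate`), and the closed `Π`-forms `TstepOf_JsBalW2Of` (any `d`) /
`TbalOf_JsBalW2Of` (the wall's family, `d = 3`; `BalabanStepJetsSucc.TbalOf_JsBalOf`).
WALL BINDERS AFTER STAGE A (for the β-lead's binder check): `(hLc : 1 ≤ Lc) (cE cVH cΛ : ℝ)` (colour weights, pinned LAST — work-order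
(P6)), `T₂` with `hT₂ : ∀ j, ∃ C δ, 0 < δ ∧ LocStencil₂ (T₂ j) C δ` (+ `hT₂t` for covariance statements), `mixFF` with
`hmix : ∃ C δ, 0 < δ ∧ LocStencilFM Lc mixFF C δ` (+ `hmixt`).  After Stage B: `mixFF`, an1's `vh₂S`, an3's `wilsonW₂` enter BY NAME and
only the colour constants remain.

THE ORDER-ONE CONSISTENCY READING (located, informal — the (D-i) item of the design record; NOTHING of this paragraph is asserted in Lean).
`BalabanStepJets.S0` / `BalabanStepJetsSucc.Sstep` carry the multiplier's first response FOLDED into the field stencil: their Lagrange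
piece is `cΛ·w • SLam (c) hessFF` with conversion coefficients `c = ℋ♭ ∘ E″` (`lamCoeffOf` / `lamCoeffK`), and `vertexOfK K` reads it
through the FIELD rows `colH` of the columns of `K`.  By the first-order identities of the typed packed resolvent (`E″·K_{fm} = Q′ᵀ·K_{mm}`
on the constraint-tangent directions, `Q′·K_{fm} = 1`, `K` symmetric ⇒ `K_{mf}·E″·K_{fm} = K_{mm}`) the folded read-out
`Σ_{(κ′,u′)} colH K (b; κ′,u′) · c(ρ,w; κ′,u′)` IS the multiplier row `colM K (b; ρ,w)` of the same column, so that — at the level of the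
manuscript's objects and up to the border-sign bookkeeping that belongs to the weight pin (SIGN-Λ item (w4)) —
`SecondOrderResponse.dM (KInvStep Lc j) Lc (Spure j) (M1 j) = OneStepKernelFamily.vertexOfK (KInvStep Lc j) Lc (Sstep j)`: the folded
chart and the Lagrangian chart agree AT ORDER ONE (they do NOT at order two — `SecondOrderResponse`, WHY THE LAGRANGIAN CHART), and the
multiplier table needs no colour constant of its own: `cM = cΛ`, with the weight check `cΛ·wΛ j·(Lc^j)^{−2(d+2)} = cΛ·wM1 j`
(`wΛ j = (Lc^j)^{4(d+2)}`, the conversion coefficients carrying `(Lc^j)^{−2(d+2)}` in the package's typed multiplier units — the UNITS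
paragraph of `BalabanStepJetsSucc`).  A kernel form of this identity needs the typed step operator `𝕄_j` and is not attempted here; the
first-order vertex of the wall's kernel stays `vertexOfK (KInvStep Lc j) Lc (JsBal⁰ j).S` with the FOLDED stencil (unchanged since
`BalabanStepJetsSucc`), and only the second-order family is built in the Lagrangian chart.  WEIGHTS (X-an2-39 §4; PROVISIONAL numerals,
pinned with the colour constants LAST): every (P4) weight is a power of `(Lc^j)^{d+2}` — `S`: `E‴` 3, (V-H) 2, `Λ` 4 ∣ `M1` 2 ∣ `S₂`: value
4, border 3 (Stage B) ∣ `M₂` 3.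

CONTENT.
* §1 TABLES: `wM1`, `wM2`, `Spure` (+ `Spure_zero` / `Spure_succ`, `rfl`), `M1`, `M2Of`; sockets `locStencil_Spure` (member `0`:
  `StepJetData.locStencil_wilsonA` + an1's `locStencil_vhS` through `locStencil_mfNeg`, rate `1`; member `j+1`:
  `BalabanStepJetsSucc.locStencil_e3Of` + the same border, its rate), `Spure_translate` ((St♭) shape: BLOCK translations `u ↦ u + Lc•t`;
  `wilsonA_translate` / `e3Of_translate` + `vhS_translate` + `mfNeg_shiftK` — exactly `S0_translate` / `Sstep_translate` minus their third
  summand), `vertexFamily_M1` (an1's `biLoc_hessFF`, any rate `δ ≥ 0`), `M1_translate` (`hessFF_translate`), `locStencilFM_M2Of`,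
  `M2Of_translate`.
* §2 THE FAMILY: `WbalOf`, `WbalOf_swap`, `vertexFamily₂_WbalOf'`, `CwOf`, `δwOf`, `δwOf_pos`, `WbalOf_loc₂`, `JsBalW2Of`, `JsBalW2Of_apply`,
  `JsBalW2Of_W` (member by member the second-order part of the UNDRESSED datum is `WbalOf j`: `BalabanStepJetsSucc.JsBal0Of_W`).
* §3 SOCKETS: `WbalOf_translate`, `JsBalW2Of_S_translate`, `JsBalW2Of_W_translate`, `TstepOf_JsBalW2Of`, `TbalOf_JsBalW2Of`.
WHAT IS NOT HERE: (a) Stage B (v1.1 of this leaf): the bi-stencil tables `T₂ (j+1) := (wV4 (j+1)) • e4Of (j+1) + (wB2 (j+1)) • (mfNeg ∘ vh₂S)`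
with the value-function fourth jet `e4Of` written STEP-RECURSIVELY through `SecondOrderResponse.dM` / `K2OfK` / `WbalOf j` (BCJ has no
composite bi-stencil), and `T₂ 0 := cE₂ • WilsonBiStencil.wilsonW₂ + border` (an3's `biLoc_wilsonW₂` / `wilsonW₂_translate` BY NAME);
(b) the tables `mixFF`, `vh₂S` (an1's node 12b, BY NAME when landed — binders here); (c) the reflection sockets (Sr)/(Wr) ((R31-1), with
an5's `refK_KInvStep` / `bref` / `reflSign` BY NAME); (d) the (A4) dictionary (P5) and the weight / sign pin (P6) incl. SIGN-Λ (w4);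
(e) any identification of `WbalOf j` with a finite-volume second derivative of Bałaban's step operator (the route's IDENTIFICATION
SENTENCE, informal); (f) NOT continuum; NOT Clay.

Provenance: β sub-cell an2 lineage, gen 11 (2026-08-19), Stage A of the (P4) family-leaf design (row file `BETA/AN2.md` §35.2); over
`Beta.SecondOrderResponse` v1.1 (`W2SymOfK`, `W2SymOfK_swap`, `vertexFamily₂_W2SymOfK'`, `W2SymOfK_translate`, `LocStencilFM`, `biLoc_smul`),
`Beta.BalabanStepJetsSucc` v1.2 (`e3Of`, `locStencil_e3Of`, `e3Of_translate`, `wE`, `wVH`, `JsBalOf`, `JsBal0Of`, `JsBal0Of_W`,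
`JsBalOf_S_translate`, `JsBalOf_W_translate`, `TstepOf_JsBalOf`, `TbalOf_JsBalOf`), `Beta.BalabanStepJets` (`locStencil_mono`,
`vertexFamily₂_mono`), `Beta.BalabanCompositeJets` (`LocStencil₂`), `Beta.StepJetData` (an2/an3: `wilsonA`, `wBound`, `locStencil_wilsonA`,
`wilsonA_translate`, `mfNeg`, `mfNeg_shiftK`, `locStencil_mfNeg`, `locStencil_add`, `locStencil_smul`), `Beta.AveragingHessianKernels` (an1:
`vhS`, `locStencil_vhS`, `vhS_translate`, `hessFF`, `biLoc_hessFF`, `hessFF_translate`, `ell`), `Beta.OneStepKernelFamily` (an4: `KInvStep`,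
`decays_KInvStep`, `shiftK_KInvStep`, `TstepOf`, `TbalOf`), `Beta.AxialDressing` (`axDressK`, `axVertexOfK`), `Beta.ExpKernelCalculus`
(`hessKer`, `shiftK`, `VertexFamily`, `VertexFamily₂`) — all BY NAME; nothing restated.

## v1.1 SUPPLEMENT (Stage B; append-only: §§1–3 of v1 are byte-identical, one import (`Beta.WilsonBiStencil`, an3) and `open` lines added)

* §4 `K3OfK` — THE SECOND RESPONSE-DERIVATIVE OF A PACKED RESOLVENT: for a kernel `K` (read `𝕄⁻¹`), first response tables `S`, `M` and a
  second response table `W`, `K3OfK K N S M W b b′ := −K·dM_b·K2OfK_{b′} − K·dM_{b′}·K2OfK_b − K·W(b,b′)·K` (`= ∂_b∂_{b′}(𝕄⁻¹)` when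
  `dM_b = ∂_b𝕄`, `K2OfK_b = ∂_b(𝕄⁻¹) = −K·∂_b𝕄·K`, `W = ∂∂𝕄`; `SecondOrderResponse.dM` / `K2OfK` BY NAME); `K3OfK_swap`; the read-out
  identities `mmRead_mul_eq_mmRead_dec` and `E2_succ_eq : E2 (j+1) = mmRead Lc (KInvStep Lc j)` (kernel, on the nose — the `(j+1)`-step
  value 2-jet IS an4's step-`j` kernel read at blocking `Lc`; NO power of `Lc`); the generic bricks `biLoc_le_mono`, `biLoc_far_of_pair`
  (PAIR + SWAP ⟹ far-small at one centre: how `(μy)↔(νy′)`-symmetric second-order families acquire the `LocStencil₂` far factor),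
  `abs_neg_sub_sub_le`, `biLoc_K3OfK_of_parts`; the FAR-SMALL LOCALISATION `biLoc_K3OfK_far` (rate `m` in, `m/32` out, far rate `m/32`;
  `ExpKernelCalculus.biLoc_comp_decays` / `biLoc_comp_biLoc`, `SecondOrderResponse.biLoc_recenter_left/right` / `biLoc_sandwich`) and the
  JOINT COARSE COVARIANCE `K3OfK_translate` (`dM_translate`, `K2OfK_translate`, `comp_shiftK`, `comp_sandwich_shiftK`).
* §5 `e4OfW j S M W := mmRead Lc ∘ K3OfK (KInvStep Lc j) Lc S M W` — THE VALUE 4-JET OF THE `(j+1)`-STEP SYSTEM IN STEP FORM (indexed by the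
  coarse bonds of the step-`j` system = the fine bonds of the step-`(j+1)` system; no `Lc` prefactor, by `E2_succ_eq`), weights `wV4 j =
  (Lc^j)^{4(d+2)}`, `wB2 j = (Lc^j)^{3(d+2)}` (provisional); `e4OfW_swap`; `vertexFamily_mono'`; `locStencil₂_e4OfW` (SOME rate `δ > 0`, from
  ∃-form hypotheses on `S`, `M` and a SYMMETRIC `VertexFamily₂` `W`); `e4OfW_translate` (ALL translations of the step-`(j+1)` lattice).
* §6 `T2Of` — THE RECURSIVE BI-STENCIL FAMILY over the binders `T` (an3's Wilson two-bond position table, through `WilsonBiStencil.wilsonW₂`),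
  `vh₂S` (an1's second-order averaging border, node 12b — a binder with hypotheses in an1's byte shapes: `∃ C δ, 0 < δ ∧ LocStencil₂ vh₂S C δ`
  and BLOCK covariance `vh₂S κ (u + Lc•t) κ′ (u′ + Lc•t) = shiftK (−Lc•t) (vh₂S κ u κ′ u′)`), `mixFF` (as in v1): `T2Of 0 = cE₂ • wilsonW₂ d T
  + cB • (mfNeg ∘ vh₂S)`, `T2Of (j+1) = (cE₂·wV4 (j+1)) • e4OfW j (Spure j) (M1 j) (WbalOf … T2Of … j) + (cB·wB2 (j+1)) • (mfNeg ∘ vh₂S)`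
  (structural recursion: member `j+1` through the second-order family of member `j`; `T2Of_zero` / `T2Of_succ` by `rfl`); `locStencil₂_smul'`,
  `locStencil₂_add'`, `locStencil₂_mfNeg`; `T2Of_loc` (every member a `LocStencil₂` family, by induction — member `j+1` through
  `SecondOrderResponse.vertexFamily₂_W2SymOfK'` AT MEMBER `j`, `WbalOf_swap`, `locStencil₂_e4OfW`) and `T2Of_translate` (joint block covariance
  of every member, by induction — `W2SymOfK_translate` at member `j`, `e4OfW_translate` at the block translation, `wilsonW₂_translate`, the
  border hypothesis, `mfNeg_shiftK`): the `hT₂` / `hT₂t` hypotheses of v1's `JsBalW2Of` / `JsBalW2Of_W_translate` are thereby DISCHARGED for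
  this family; §6b the instantiated objects `WbalT2Of`, `JsBalT2Of` (`= JsBalW2Of … (T2Of_loc …)`, `JsBalT2Of_eq`), sockets
  `JsBalT2Of_W_translate` (only the two BORDER covariance hypotheses remain), `JsBalT2Of_S_translate`, and the wall identity `TbalOf_JsBalT2Of`
  (`d = 3`, `TbalOf_JsBalW2Of` BY NAME).
READING (docstring-level, never a hypothesis): with `K_j = KInvStep Lc j` the step-`j` packed resolvent in an4's normalisation and the
response tables of the step-`j` system, `e4OfW j` is the table of second bond-derivatives `∂_b∂_{b′}` of the multiplier block of `K_j` read
at the next coarse points, i.e. of `E2 (j+1)` regarded as a function of the step-`j` background — the value 4-jet that the `(j+1)`-st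
step's stencil tables need at second order; the IDENTIFICATION of `WbalOf`/`T2Of` with second derivatives of Bałaban's finite-volume
step operator is the route's informal identification sentence and is NOT asserted.  Binders left after v1.1: `T` (by value, no
hypothesis), `vh₂S` (+ `hB`, `hBt`), `mixFF` (+ `hmix`, `hmixt`), the colour constants `cE cVH cΛ cE₂ cB` (pinned LAST, (P6)).
STILL NOT HERE: (b)–(f) of the list above; no uniformity in `j` of any rate or constant is claimed anywhere.

All declarations are [folklore]: definitions, or proved here from the imports; zero cited facts; zero `sorry`.
-/

noncomputable section

open Finset
open scoped BigOperators
open Literature.MathematicalPhysics.QuantumFieldTheory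
open Literature.MathematicalPhysics.QuantumFieldTheory.Balaban1983to89
open Literature.MathematicalPhysics.QuantumFieldTheory.Balaban1983to89.Beta
open B12Sec2to5 (l1 l1_nonneg)
open ExpKernelCalculus (MKer Decays BiLoc VertexFamily VertexFamily₂ hessKer shiftK)
open OneStepResolventKernel (Fib LocStencil JetData biLoc_mono)
open OneStepKernelFamily (KInvStep decays_KInvStep shiftK_KInvStep vertexOfK TstepOf TbalOf)
open StepJetData (wilsonA wBound locStencil_wilsonA wilsonA_translate mfNeg mfNeg_shiftK locStencil_mfNeg locStencil_add locStencil_smul)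
open AveragingHessianKernels (vhS locStencil_vhS vhS_translate hessFF biLoc_hessFF hessFF_translate ell)
open BalabanStepJets (S0 locStencil_mono vertexFamily₂_mono)
open BalabanCompositeJets (LocStencil₂)
open AxialDressing (dress axDressK axVertexOfK)
open BalabanStepJetsSucc (e3Of locStencil_e3Of e3Of_translate wE wVH Sstep JsBal0Of JsBalOf JsBal0Of_W JsBalOf_S_translate
  JsBalOf_W_translate TstepOf_JsBalOf TbalOf_JsBalOf)
open SecondOrderResponse (W2SymOfK W2SymOfK_swap LocStencilFM vertexFamily₂_W2SymOfK' W2SymOfK_translate biLoc_smul)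

open ExpKernelCalculus (comp comp_shiftK Zl Zl_nonneg l1_sub_triangle l1_sub_symm biLoc_comp_decays biLoc_comp_biLoc)
open OneStepResolventKernel (KInv bound_mono decays_mono)
open OneStepKernelFamily (dec)
open StepJetData (biLoc_mfNeg)
open BalabanStepJetsSucc (mmRead mmRead_eq_dec mmRead_inl_inl biLoc_mmRead mmRead_shiftK_smul comp_sandwich_shiftK l1_sub_le_l1_smul_sub E2)
open SecondOrderResponse (dM K2OfK vertexFamily_dM vertexFamily_K2OfK cdM cK2 cdM_nonneg cK2_nonneg biLoc_sandwich biLoc_recenter_left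
  biLoc_recenter_right dM_translate K2OfK_translate)
open WilsonBiStencil (wilsonW₂ wBound₂ biLoc_wilsonW₂ wilsonW₂_translate)

namespace Literature.MathematicalPhysics.QuantumFieldTheory.Balaban1983to89.Beta.BalabanStepW2

/-! ## §1 The Lagrangian-chart first-order tables of the step-`j` operator: `Spure` (field) and `M1` (multiplier); the weighted
## mixed table `M2Of` -/

section Tables

variable (d : ℕ) (Lc : ℕ) [NeZero Lc]

/-- [folklore] WEIGHT of the multiplier table `M1` at step `j`: `(Lc^j)^{2(d+2)}` (PROVISIONAL numeral; every (P4) weight is a power of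
`(Lc^j)^{d+2}`, pinned with the colour constants LAST). -/
def wM1 (j : ℕ) : ℝ := ((Lc : ℝ) ^ j) ^ (2 * (d + 2))

/-- [folklore] WEIGHT of the mixed field–multiplier table `M₂` at step `j`: `(Lc^j)^{3(d+2)}` (PROVISIONAL numeral). -/
def wM2 (j : ℕ) : ℝ := ((Lc : ℝ) ^ j) ^ (3 * (d + 2))

/-- [folklore] **THE UNFOLDED FIRST FIELD STENCIL OF THE STEP-`j` OPERATOR** (the partial `U`-derivative table in the Lagrangian chart):
`BalabanStepJets.S0` (member `0`) / `BalabanStepJetsSucc.Sstep (j+1)` (member `j+1`) WITHOUT their Lagrange piece `cΛ • SLam …` —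
member `0`: `cE • wilsonA κ′ u′ + cVH • mfNeg (vhS Lc κ′ u′)` (Wilson cubic vertex + one-step border); member `j+1`:
`(cE·wE (j+1)) • e3Of (j+1) κ′ u′ + (cVH·wVH (j+1)) • mfNeg (vhS Lc κ′ u′)` (value-function third jet + the same border).  (`cΛ` enters
member `j+1` only through `e3Of`, whose composite stencil `Sc j` carries the folded Lagrange pieces of the PREVIOUS levels.) -/
def Spure (cE cVH cΛ : ℝ) : ℕ → Fin (d + 1) → (Fin (d + 1) → ℤ) → MKer (d + 1) (Fib d)
  | 0 => fun κ' u' => cE • wilsonA d κ' u' + cVH • mfNeg (vhS d Lc κ' u')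
  | j + 1 => fun κ' u' =>
      (cE * wE d Lc (j + 1)) • e3Of d Lc cE cVH cΛ (j + 1) κ' u' + (cVH * wVH d Lc (j + 1)) • mfNeg (vhS d Lc κ' u')

/-- [folklore] **THE FIRST MULTIPLIER TABLE OF THE STEP-`j` OPERATOR** (the partial `φ`-derivative table in the Lagrangian chart):
`M1 j ρ w := (cΛ·wM1 j) • hessFF Lc ρ w` — an1's constraint Hessian `Q″_{(ρ,w)}(1)` of the one-step averaging at the coarse bond, with the
colour constant `cΛ` of the Lagrange piece (no new constant: the order-one consistency reading of the module docstring). -/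
def M1 (cΛ : ℝ) (j : ℕ) : Fin (d + 1) → (Fin (d + 1) → ℤ) → MKer (d + 1) (Fib d) :=
  fun ρ w => (cΛ * wM1 d Lc j) • hessFF Lc ρ w

/-- [folklore] **THE WEIGHTED MIXED TABLE** `M2Of mixFF j κ u ρ w := (wM2 j) • mixFF κ u ρ w` over the binder table `mixFF` (an1's mixed
field–multiplier jet of the averaging Hessian, BY NAME when landed; its colour weight stays inside the binder until the weight pin). -/
def M2Of (mixFF : Fin (d + 1) → (Fin (d + 1) → ℤ) → Fin (d + 1) → (Fin (d + 1) → ℤ) → MKer (d + 1) (Fib d)) (j : ℕ) :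
    Fin (d + 1) → (Fin (d + 1) → ℤ) → Fin (d + 1) → (Fin (d + 1) → ℤ) → MKer (d + 1) (Fib d) :=
  fun κ u ρ w => wM2 d Lc j • mixFF κ u ρ w

variable {d Lc}

/-- [folklore] Member `0` of `Spure`, by `rfl`. -/
@[simp] theorem Spure_zero (cE cVH cΛ : ℝ) :
    Spure d Lc cE cVH cΛ 0 = fun κ' u' => cE • wilsonA d κ' u' + cVH • mfNeg (vhS d Lc κ' u') := rfl

/-- [folklore] Member `j+1` of `Spure`, by `rfl`. -/
@[simp] theorem Spure_succ (cE cVH cΛ : ℝ) (j : ℕ) :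
    Spure d Lc cE cVH cΛ (j + 1) = fun κ' u' =>
      (cE * wE d Lc (j + 1)) • e3Of d Lc cE cVH cΛ (j + 1) κ' u' + (cVH * wVH d Lc (j + 1)) • mfNeg (vhS d Lc κ' u') := rfl

/-- [folklore] **`Spure j` IS A LOCAL STENCIL FAMILY** (some rate `δ > 0`): member `0` from `StepJetData.locStencil_wilsonA` and an1's
`locStencil_vhS` through `locStencil_mfNeg` (rate `1`); member `j+1` from `BalabanStepJetsSucc.locStencil_e3Of` and the same border at
its rate; assembled by `locStencil_add` / `locStencil_smul`.  Existential at fixed `Lc`, `j`; no uniformity claimed. -/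
theorem locStencil_Spure (hLc : 1 ≤ Lc) (cE cVH cΛ : ℝ) :
    ∀ j : ℕ, ∃ Cs δ : ℝ, 0 < δ ∧ LocStencil (Spure d Lc cE cVH cΛ j) Cs δ
  | 0 => by
    have h1 : LocStencil (wilsonA d) (wBound d * Real.exp (4 * 1)) 1 := locStencil_wilsonA zero_le_one
    have h2 : LocStencil (fun κ' u => mfNeg (vhS d Lc κ' u))
        (3 * (ell (d + 1) Lc : ℝ) ^ 2 * Real.exp (4 * ((d : ℝ) + 1) * Lc * 1)) 1 :=
      locStencil_mfNeg (locStencil_vhS hLc zero_le_one)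
    rw [Spure_zero]
    exact ⟨_, 1, one_pos, locStencil_add (locStencil_smul cE h1) (locStencil_smul cVH h2)⟩
  | j + 1 => by
    obtain ⟨C₁, δ₁, hδ₁, h1⟩ := locStencil_e3Of (d := d) (Lc := Lc) hLc cE cVH cΛ (j + 1)
    have h2 : LocStencil (fun κ' u => mfNeg (vhS d Lc κ' u))
        (3 * (ell (d + 1) Lc : ℝ) ^ 2 * Real.exp (4 * ((d : ℝ) + 1) * Lc * δ₁)) δ₁ :=
      locStencil_mfNeg (locStencil_vhS hLc hδ₁.le)
    rw [Spure_succ]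
    exact ⟨_, δ₁, hδ₁, locStencil_add (locStencil_smul (cE * wE d Lc (j + 1)) h1) (locStencil_smul (cVH * wVH d Lc (j + 1)) h2)⟩

/-- [folklore] **(St♭) FOR `Spure`**: every member is covariant under the BLOCK translations `u ↦ u + Lc•t` of its lattice —
`Spure j κ′ (u + Lc•t) = shiftK (−Lc•t) (Spure j κ′ u)` (member `0`: `wilsonA_translate`; member `j+1`: `e3Of_translate` at `t′ = Lc•t`;
both: an1's `vhS_translate` through `mfNeg_shiftK`) — exactly `BalabanStepJets.S0_translate` / `BalabanStepJetsSucc.Sstep_translate`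
without their third summand; the `hS` hypothesis of `SecondOrderResponse.W2SymOfK_translate`. -/
theorem Spure_translate (hLc : 1 ≤ Lc) (cE cVH cΛ : ℝ) : ∀ (j : ℕ) (κ' : Fin (d + 1)) (u t : Fin (d + 1) → ℤ),
    Spure d Lc cE cVH cΛ j κ' (u + (Lc : ℤ) • t) = shiftK (-((Lc : ℤ) • t)) (Spure d Lc cE cVH cΛ j κ' u)
  | 0, κ', u, t => by
    have h1 := wilsonA_translate (d := d) κ' u ((Lc : ℤ) • t)
    have h2 := vhS_translate (d := d) hLc κ' u t
    funext x z a b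
    simp only [Spure_zero, Pi.add_apply, Pi.smul_apply, smul_eq_mul, shiftK]
    rw [h1, h2, mfNeg_shiftK]
    rfl
  | j + 1, κ', u, t => by
    have h1 := e3Of_translate (d := d) hLc cE cVH cΛ j κ' u ((Lc : ℤ) • t)
    have h2 := vhS_translate (d := d) hLc κ' u t
    funext x z a b
    simp only [Spure_succ, Pi.add_apply, Pi.smul_apply, smul_eq_mul, shiftK]
    rw [h1, h2, mfNeg_shiftK]
    rfl

omit [NeZero Lc] in
/-- [folklore] **`M1 j` IS A VERTEX FAMILY** at blocking `Lc`, at ANY rate `δ ≥ 0` (an1's `biLoc_hessFF`: the constraint Hessian is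
finitely supported around the coarse bond), constant `|cΛ·wM1 j|·(2ℓ²·e^{4(d+1)Lc·δ})`. -/
theorem vertexFamily_M1 (hLc : 1 ≤ Lc) (cΛ : ℝ) (j : ℕ) {δ : ℝ} (hδ : 0 ≤ δ) :
    VertexFamily (M1 d Lc cΛ j) Lc
      (|cΛ * wM1 d Lc j| * (2 * (ell (d + 1) Lc : ℝ) ^ 2 * Real.exp (4 * ((d : ℝ) + 1) * Lc * δ))) δ :=
  fun ρ w => biLoc_smul (cΛ * wM1 d Lc j) (biLoc_hessFF hLc ρ w hδ)

omit [NeZero Lc] in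
/-- [folklore] **COARSE-TRANSLATION COVARIANCE OF `M1`** (the `hM` hypothesis of `W2SymOfK_translate`): `M1 j ρ (w + t) = shiftK (−Lc•t)
(M1 j ρ w)` — an1's `hessFF_translate`. -/
theorem M1_translate (cΛ : ℝ) (j : ℕ) (ρ : Fin (d + 1)) (w t : Fin (d + 1) → ℤ) :
    M1 d Lc cΛ j ρ (w + t) = shiftK (-((Lc : ℤ) • t)) (M1 d Lc cΛ j ρ w) := by
  funext x z a b
  simp only [M1, Pi.smul_apply, smul_eq_mul, shiftK]
  rw [hessFF_translate ρ w t]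
  rfl

omit [NeZero Lc] in
/-- [folklore] The weighted mixed table inherits the `LocStencilFM` shape of the binder table (constant `|wM2 j|·C`, same rate). -/
theorem locStencilFM_M2Of {mixFF : Fin (d + 1) → (Fin (d + 1) → ℤ) → Fin (d + 1) → (Fin (d + 1) → ℤ) → MKer (d + 1) (Fib d)}
    {C δ : ℝ} (h : LocStencilFM Lc mixFF C δ) (j : ℕ) : LocStencilFM Lc (M2Of d Lc mixFF j) (|wM2 d Lc j| * C) δ := by
  intro κ u ρ w
  show BiLoc (wM2 d Lc j • mixFF κ u ρ w) u u (|wM2 d Lc j| * C * Real.exp (-δ * l1 (u - (Lc : ℤ) • w))) δ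
  rw [mul_assoc]
  exact biLoc_smul (wM2 d Lc j) (h κ u ρ w)

omit [NeZero Lc] in
/-- [folklore] The weighted mixed table inherits the JOINT block covariance of the binder table (the `hM₂` hypothesis of
`W2SymOfK_translate`): `M2Of j κ (u + Lc•t) ρ (w + t) = shiftK (−Lc•t) (M2Of j κ u ρ w)`. -/
theorem M2Of_translate {mixFF : Fin (d + 1) → (Fin (d + 1) → ℤ) → Fin (d + 1) → (Fin (d + 1) → ℤ) → MKer (d + 1) (Fib d)}
    (hmixt : ∀ (κ : Fin (d + 1)) (u : Fin (d + 1) → ℤ) (ρ : Fin (d + 1)) (w t : Fin (d + 1) → ℤ),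
      mixFF κ (u + (Lc : ℤ) • t) ρ (w + t) = shiftK (-((Lc : ℤ) • t)) (mixFF κ u ρ w))
    (j : ℕ) (κ : Fin (d + 1)) (u : Fin (d + 1) → ℤ) (ρ : Fin (d + 1)) (w t : Fin (d + 1) → ℤ) :
    M2Of d Lc mixFF j κ (u + (Lc : ℤ) • t) ρ (w + t) = shiftK (-((Lc : ℤ) • t)) (M2Of d Lc mixFF j κ u ρ w) := by
  funext x z a b
  simp only [M2Of, Pi.smul_apply, smul_eq_mul, shiftK]
  rw [hmixt κ u ρ w t]
  rfl

end Tables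

/-! ## §2 The second-order family of Bałaban's step jets over the two table binders, and the instantiated dressed family -/

section Family

variable (d : ℕ) (Lc : ℕ) [NeZero Lc]

/-- [folklore] **THE SECOND-ORDER BACKGROUND FAMILY OF BAŁABAN'S STEP JETS, MEMBER `j`** (Lagrangian chart, swap-symmetrised carrier of
`SecondOrderResponse` through an4's decimated composite resolvent):
`WbalOf cE cVH cΛ T₂ mixFF j := W2SymOfK (KInvStep Lc j) Lc (Spure j) (M1 j) (T₂ j) (M2Of mixFF j)` — first-order tables from §1, the
fine bi-stencil tables `T₂ j` and the mixed table `mixFF` as BINDERS. -/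
def WbalOf (cE cVH cΛ : ℝ)
    (T₂ : ℕ → Fin (d + 1) → (Fin (d + 1) → ℤ) → Fin (d + 1) → (Fin (d + 1) → ℤ) → MKer (d + 1) (Fib d))
    (mixFF : Fin (d + 1) → (Fin (d + 1) → ℤ) → Fin (d + 1) → (Fin (d + 1) → ℤ) → MKer (d + 1) (Fib d)) (j : ℕ) :
    Fin (d + 1) → (Fin (d + 1) → ℤ) → Fin (d + 1) → (Fin (d + 1) → ℤ) → MKer (d + 1) (Fib d) :=
  W2SymOfK (KInvStep (d := d) Lc j) Lc (Spure d Lc cE cVH cΛ j) (M1 d Lc cΛ j) (T₂ j) (M2Of d Lc mixFF j)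

variable {d Lc}

/-- [folklore] **SWAP SYMMETRY OF THE FAMILY** (β-lead binder item (w1): «SYMMETRY in (μy)↔(νy′) stated, or the symmetrised table used» —
both: `SecondOrderResponse.W2SymOfK_swap`). -/
theorem WbalOf_swap (cE cVH cΛ : ℝ)
    (T₂ : ℕ → Fin (d + 1) → (Fin (d + 1) → ℤ) → Fin (d + 1) → (Fin (d + 1) → ℤ) → MKer (d + 1) (Fib d))
    (mixFF : Fin (d + 1) → (Fin (d + 1) → ℤ) → Fin (d + 1) → (Fin (d + 1) → ℤ) → MKer (d + 1) (Fib d)) (j : ℕ)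
    (μ : Fin (d + 1)) (y : Fin (d + 1) → ℤ) (ν : Fin (d + 1)) (y' : Fin (d + 1) → ℤ) :
    WbalOf d Lc cE cVH cΛ T₂ mixFF j ν y' μ y = WbalOf d Lc cE cVH cΛ T₂ mixFF j μ y ν y' :=
  W2SymOfK_swap _ _ _ _ _ _ μ y ν y'

/-- [folklore] **THE `loc₂` SOCKET OF THE FAMILY**: for bi-stencil tables and a mixed table localised at SOME positive rates, every member
`WbalOf … j` is a second-order vertex family at blocking `Lc` at SOME positive rate — `SecondOrderResponse.vertexFamily₂_W2SymOfK'` fed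
with an4's `decays_KInvStep j`, `locStencil_Spure`, `vertexFamily_M1` (rate `1`), the binder hypotheses and `locStencilFM_M2Of`.
Existential at fixed `Lc`, `j`; no uniformity in `j` claimed (none is needed by the wall's binder block). -/
theorem vertexFamily₂_WbalOf' (hLc : 1 ≤ Lc) (cE cVH cΛ : ℝ)
    {T₂ : ℕ → Fin (d + 1) → (Fin (d + 1) → ℤ) → Fin (d + 1) → (Fin (d + 1) → ℤ) → MKer (d + 1) (Fib d)}
    {mixFF : Fin (d + 1) → (Fin (d + 1) → ℤ) → Fin (d + 1) → (Fin (d + 1) → ℤ) → MKer (d + 1) (Fib d)}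
    (hT₂ : ∀ j, ∃ C δ : ℝ, 0 < δ ∧ LocStencil₂ (T₂ j) C δ) (hmix : ∃ C δ : ℝ, 0 < δ ∧ LocStencilFM Lc mixFF C δ) (j : ℕ) :
    ∃ Cw δw : ℝ, 0 < δw ∧ VertexFamily₂ (WbalOf d Lc cE cVH cΛ T₂ mixFF j) Lc Cw δw := by
  obtain ⟨Cs, δs, hδs, hS⟩ := locStencil_Spure (d := d) (Lc := Lc) hLc cE cVH cΛ j
  obtain ⟨C₂, δ₂, hδ₂, hS₂⟩ := hT₂ j
  obtain ⟨CM₂, δ₃, hδ₃, hM₂⟩ := hmix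
  exact vertexFamily₂_W2SymOfK' (decays_KInvStep (Lc := Lc) (d := d) j) hS hδs (vertexFamily_M1 hLc cΛ j zero_le_one) one_pos
    hS₂ hδ₂ (locStencilFM_M2Of hM₂ j) hδ₃

section Choice

variable (hLc : 1 ≤ Lc) (cE cVH cΛ : ℝ)
    {T₂ : ℕ → Fin (d + 1) → (Fin (d + 1) → ℤ) → Fin (d + 1) → (Fin (d + 1) → ℤ) → MKer (d + 1) (Fib d)}
    {mixFF : Fin (d + 1) → (Fin (d + 1) → ℤ) → Fin (d + 1) → (Fin (d + 1) → ℤ) → MKer (d + 1) (Fib d)}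
    (hT₂ : ∀ j, ∃ C δ : ℝ, 0 < δ ∧ LocStencil₂ (T₂ j) C δ) (hmix : ∃ C δ : ℝ, 0 < δ ∧ LocStencilFM Lc mixFF C δ)

/-- [folklore] The packaged localisation CONSTANT of member `j` (`Classical.choose` of `vertexFamily₂_WbalOf'`). -/
def CwOf (j : ℕ) : ℝ := (vertexFamily₂_WbalOf' (d := d) hLc cE cVH cΛ hT₂ hmix j).choose

/-- [folklore] The packaged localisation RATE of member `j` (`Classical.choose` of `vertexFamily₂_WbalOf'`). -/
def δwOf (j : ℕ) : ℝ := (vertexFamily₂_WbalOf' (d := d) hLc cE cVH cΛ hT₂ hmix j).choose_spec.choose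

/-- [folklore] The packaged rate is positive. -/
theorem δwOf_pos (j : ℕ) : 0 < δwOf hLc cE cVH cΛ hT₂ hmix j :=
  (vertexFamily₂_WbalOf' (d := d) hLc cE cVH cΛ hT₂ hmix j).choose_spec.choose_spec.1

/-- [folklore] **THE `hW` BINDER OF `JsBalOf`, DISCHARGED FOR THE FAMILY**: `VertexFamily₂ (WbalOf … j) Lc (CwOf … j) (δwOf … j)`. -/
theorem WbalOf_loc₂ (j : ℕ) :
    VertexFamily₂ (WbalOf d Lc cE cVH cΛ T₂ mixFF j) Lc (CwOf hLc cE cVH cΛ hT₂ hmix j) (δwOf hLc cE cVH cΛ hT₂ hmix j) :=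
  (vertexFamily₂_WbalOf' (d := d) hLc cE cVH cΛ hT₂ hmix j).choose_spec.choose_spec.2

/-- [folklore] **BAŁABAN'S DRESSED STEP-JET FAMILY WITH ITS SECOND-ORDER TABLES** (Stage A: over the two table binders):
`JsBalW2Of := BalabanStepJetsSucc.JsBalOf hLc cE cVH cΛ (WbalOf …) (CwOf …) (δwOf …) (δwOf_pos …) (WbalOf_loc₂ …)` — the literal of route
(α) (`JsBal = dress ∘ JsBal⁰`) with `W j := WbalOf … j`.  The wall reads `OneStepKernelFamily.D1Drift Lc (JsBalW2Of …) N μ ν`. -/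
def JsBalW2Of : ℕ → JetData d Lc :=
  JsBalOf hLc cE cVH cΛ (WbalOf d Lc cE cVH cΛ T₂ mixFF) (CwOf hLc cE cVH cΛ hT₂ hmix) (δwOf hLc cE cVH cΛ hT₂ hmix)
    (δwOf_pos hLc cE cVH cΛ hT₂ hmix) (WbalOf_loc₂ hLc cE cVH cΛ hT₂ hmix)

/-- [folklore] `JsBalW2Of` IS `JsBalOf` at `W := WbalOf`, by `rfl` — every socket lemma of the imports applies BY NAME. -/
theorem JsBalW2Of_apply :
    JsBalW2Of hLc cE cVH cΛ hT₂ hmix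
      = JsBalOf hLc cE cVH cΛ (WbalOf d Lc cE cVH cΛ T₂ mixFF) (CwOf hLc cE cVH cΛ hT₂ hmix) (δwOf hLc cE cVH cΛ hT₂ hmix)
          (δwOf_pos hLc cE cVH cΛ hT₂ hmix) (WbalOf_loc₂ hLc cE cVH cΛ hT₂ hmix) := rfl

/-- [folklore] Member by member, the second-order part of the UNDRESSED datum is `WbalOf j` (`BalabanStepJetsSucc.JsBal0Of_W`). -/
theorem JsBal0W2Of_W (j : ℕ) :
    (JsBal0Of hLc cE cVH cΛ (WbalOf d Lc cE cVH cΛ T₂ mixFF) (CwOf hLc cE cVH cΛ hT₂ hmix) (δwOf hLc cE cVH cΛ hT₂ hmix)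
        (δwOf_pos hLc cE cVH cΛ hT₂ hmix) (WbalOf_loc₂ hLc cE cVH cΛ hT₂ hmix) j).W = WbalOf d Lc cE cVH cΛ T₂ mixFF j :=
  JsBal0Of_W hLc cE cVH cΛ _ _ _ _ _ j

end Choice

end Family

/-! ## §3 Sockets of the instantiated family: (Wt), (St♭), and the closed `Π`-forms of the step kernels -/

section Sockets

variable {d : ℕ} {Lc : ℕ} [NeZero Lc]

/-- [folklore] **(Wt) FOR THE FAMILY**: if the bi-stencil tables are JOINTLY block-covariant (`hT₂t`) and the mixed table is jointly
covariant (`hmixt` — fine slot by the block translation, coarse slot by `t`), then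
`WbalOf … j μ (y + t) ν (y′ + t) = shiftK (−Lc•t) (WbalOf … j μ y ν y′)` — `SecondOrderResponse.W2SymOfK_translate` fed with an4's
`shiftK_KInvStep j`, `Spure_translate`, `M1_translate`, `hT₂t j`, `M2Of_translate hmixt j`.  This is the `hWt` hypothesis of
`BalabanStepJetsSucc.JsBalOf_W_translate` for `W := WbalOf`. -/
theorem WbalOf_translate (hLc : 1 ≤ Lc) (cE cVH cΛ : ℝ)
    {T₂ : ℕ → Fin (d + 1) → (Fin (d + 1) → ℤ) → Fin (d + 1) → (Fin (d + 1) → ℤ) → MKer (d + 1) (Fib d)}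
    {mixFF : Fin (d + 1) → (Fin (d + 1) → ℤ) → Fin (d + 1) → (Fin (d + 1) → ℤ) → MKer (d + 1) (Fib d)}
    (hT₂t : ∀ (j : ℕ) (κ : Fin (d + 1)) (u : Fin (d + 1) → ℤ) (κ' : Fin (d + 1)) (u' t : Fin (d + 1) → ℤ),
      T₂ j κ (u + (Lc : ℤ) • t) κ' (u' + (Lc : ℤ) • t) = shiftK (-((Lc : ℤ) • t)) (T₂ j κ u κ' u'))
    (hmixt : ∀ (κ : Fin (d + 1)) (u : Fin (d + 1) → ℤ) (ρ : Fin (d + 1)) (w t : Fin (d + 1) → ℤ),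
      mixFF κ (u + (Lc : ℤ) • t) ρ (w + t) = shiftK (-((Lc : ℤ) • t)) (mixFF κ u ρ w))
    (j : ℕ) (μ : Fin (d + 1)) (y : Fin (d + 1) → ℤ) (ν : Fin (d + 1)) (y' t : Fin (d + 1) → ℤ) :
    WbalOf d Lc cE cVH cΛ T₂ mixFF j μ (y + t) ν (y' + t) = shiftK (-((Lc : ℤ) • t)) (WbalOf d Lc cE cVH cΛ T₂ mixFF j μ y ν y') :=
  W2SymOfK_translate (N := Lc) (fun s => shiftK_KInvStep (Lc := Lc) (d := d) j s) (Spure_translate hLc cE cVH cΛ j)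
    (M1_translate (Lc := Lc) cΛ j) (hT₂t j) (M2Of_translate (Lc := Lc) hmixt j) μ y ν y' t

variable (hLc : 1 ≤ Lc) (cE cVH cΛ : ℝ)
    {T₂ : ℕ → Fin (d + 1) → (Fin (d + 1) → ℤ) → Fin (d + 1) → (Fin (d + 1) → ℤ) → MKer (d + 1) (Fib d)}
    {mixFF : Fin (d + 1) → (Fin (d + 1) → ℤ) → Fin (d + 1) → (Fin (d + 1) → ℤ) → MKer (d + 1) (Fib d)}
    (hT₂ : ∀ j, ∃ C δ : ℝ, 0 < δ ∧ LocStencil₂ (T₂ j) C δ) (hmix : ∃ C δ : ℝ, 0 < δ ∧ LocStencilFM Lc mixFF C δ)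

/-- [folklore] **(St♭) FOR THE INSTANTIATED DRESSED FAMILY**, every member (`BalabanStepJetsSucc.JsBalOf_S_translate`, BY NAME). -/
theorem JsBalW2Of_S_translate (j : ℕ) (κ' : Fin (d + 1)) (u t : Fin (d + 1) → ℤ) :
    (JsBalW2Of hLc cE cVH cΛ hT₂ hmix j).S κ' (u + (Lc : ℤ) • t)
      = shiftK (-((Lc : ℤ) • t)) ((JsBalW2Of hLc cE cVH cΛ hT₂ hmix j).S κ' u) :=
  JsBalOf_S_translate hLc cE cVH cΛ _ _ _ _ _ j κ' u t

/-- [folklore] **(Wt) FOR THE INSTANTIATED DRESSED FAMILY**, every member, from the joint covariance of the two binder tables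
(`WbalOf_translate` into `BalabanStepJetsSucc.JsBalOf_W_translate`). -/
theorem JsBalW2Of_W_translate
    (hT₂t : ∀ (j : ℕ) (κ : Fin (d + 1)) (u : Fin (d + 1) → ℤ) (κ' : Fin (d + 1)) (u' t : Fin (d + 1) → ℤ),
      T₂ j κ (u + (Lc : ℤ) • t) κ' (u' + (Lc : ℤ) • t) = shiftK (-((Lc : ℤ) • t)) (T₂ j κ u κ' u'))
    (hmixt : ∀ (κ : Fin (d + 1)) (u : Fin (d + 1) → ℤ) (ρ : Fin (d + 1)) (w t : Fin (d + 1) → ℤ),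
      mixFF κ (u + (Lc : ℤ) • t) ρ (w + t) = shiftK (-((Lc : ℤ) • t)) (mixFF κ u ρ w))
    (j : ℕ) (μ : Fin (d + 1)) (y : Fin (d + 1) → ℤ) (ν : Fin (d + 1)) (y' t : Fin (d + 1) → ℤ) :
    (JsBalW2Of hLc cE cVH cΛ hT₂ hmix j).W μ (y + t) ν (y' + t)
      = shiftK (-((Lc : ℤ) • t)) ((JsBalW2Of hLc cE cVH cΛ hT₂ hmix j).W μ y ν y') :=
  JsBalOf_W_translate hLc cE cVH cΛ _ _ _ _ _ (WbalOf_translate hLc cE cVH cΛ hT₂t hmixt) j μ y ν y' t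

/-- [folklore] **THE STEP KERNELS OF THE INSTANTIATED FAMILY IN CLOSED `Π`-FORM** (any `d`; `BalabanStepJetsSucc.TstepOf_JsBalOf`):
`TstepOf Lc j (JsBalW2 j) = hessKer (Π·KInvStep Lc j·Π) (V^Π_{KInvStep Lc j} (JsBal⁰ j).S) (WbalOf … j)`. -/
theorem TstepOf_JsBalW2Of (j : ℕ) :
    TstepOf Lc j (JsBalW2Of hLc cE cVH cΛ hT₂ hmix j)
      = hessKer (axDressK Lc (KInvStep (d := d) Lc j))
          (axVertexOfK (KInvStep (d := d) Lc j) Lc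
            (JsBal0Of hLc cE cVH cΛ (WbalOf d Lc cE cVH cΛ T₂ mixFF) (CwOf hLc cE cVH cΛ hT₂ hmix) (δwOf hLc cE cVH cΛ hT₂ hmix)
              (δwOf_pos hLc cE cVH cΛ hT₂ hmix) (WbalOf_loc₂ hLc cE cVH cΛ hT₂ hmix) j).S)
          (WbalOf d Lc cE cVH cΛ T₂ mixFF j) :=
  TstepOf_JsBalOf hLc cE cVH cΛ _ _ _ _ _ j

end Sockets

section Wall

variable {Lc : ℕ} [NeZero Lc] (hLc : 1 ≤ Lc) (cE cVH cΛ : ℝ)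
    {T₂ : ℕ → Fin (3 + 1) → (Fin (3 + 1) → ℤ) → Fin (3 + 1) → (Fin (3 + 1) → ℤ) → MKer (3 + 1) (Fib 3)}
    {mixFF : Fin (3 + 1) → (Fin (3 + 1) → ℤ) → Fin (3 + 1) → (Fin (3 + 1) → ℤ) → MKer (3 + 1) (Fib 3)}
    (hT₂ : ∀ j, ∃ C δ : ℝ, 0 < δ ∧ LocStencil₂ (T₂ j) C δ) (hmix : ∃ C δ : ℝ, 0 < δ ∧ LocStencilFM Lc mixFF C δ)

/-- [folklore] **THE WALL'S FAMILY WITH ITS SECOND-ORDER TABLES, MEMBER BY MEMBER** (dimension four, `d = 3`;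
`BalabanStepJetsSucc.TbalOf_JsBalOf`): `TbalOf Lc (JsBalW2Of …) j` in closed `Π`-form with second-order family `WbalOf … j` — the object
`OneStepKernelFamily.D1Drift Lc (JsBalW2Of …) N μ ν` reads. -/
theorem TbalOf_JsBalW2Of (j : ℕ) :
    TbalOf Lc (JsBalW2Of hLc cE cVH cΛ hT₂ hmix) j
      = hessKer (axDressK Lc (KInvStep (d := 3) Lc j))
          (axVertexOfK (KInvStep (d := 3) Lc j) Lc
            (JsBal0Of hLc cE cVH cΛ (WbalOf 3 Lc cE cVH cΛ T₂ mixFF) (CwOf hLc cE cVH cΛ hT₂ hmix) (δwOf hLc cE cVH cΛ hT₂ hmix)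
              (δwOf_pos hLc cE cVH cΛ hT₂ hmix) (WbalOf_loc₂ hLc cE cVH cΛ hT₂ hmix) j).S)
          (WbalOf 3 Lc cE cVH cΛ T₂ mixFF j) :=
  TbalOf_JsBalOf hLc cE cVH cΛ _ _ _ _ _ j

end Wall

/-! ## §4 The second response-derivative of a packed resolvent: `K3OfK`, its far-small localisation and covariance -/

section ReadOut

variable {d : ℕ}

/-- [folklore] **READ-OUT AT THE PRODUCT MESH = READ-OUT AFTER DECIMATION**: `mmRead (M·L) F = mmRead L (dec M F)`. -/
theorem mmRead_mul_eq_mmRead_dec (M L : ℕ) (F : MKer (d + 1) (Fib d)) : mmRead (M * L) F = mmRead L (dec M F) := by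
  funext x' z' a b
  rcases a with α | μ <;> rcases b with β | ν
  · rw [mmRead_inl_inl, mmRead_inl_inl, ← mmRead_eq_dec, mmRead_inl_inl, smul_smul, smul_smul, Nat.cast_mul]
  · rfl
  · rfl
  · rfl

variable {Lc : ℕ} [NeZero Lc]

/-- [folklore] **THE VALUE 2-JET OF THE `(j+1)`-STEP SYSTEM IN STEP FORM, ON THE NOSE**: `E2 (j+1) = mmRead Lc (KInvStep Lc j)` — the
multiplier block of the `(j+1)`-fold composite resolvent read at its coarse points IS the multiplier block of an4's step-`j` kernel
read at blocking `Lc` (the `dec` legs carry weight one).  No power of `Lc` appears. -/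
theorem E2_succ_eq (j : ℕ) : E2 d Lc (j + 1) = mmRead Lc (KInvStep (d := d) Lc j) := by
  have h : (mmRead (Lc ^ (j + 1)) : MKer (d + 1) (Fib d) → MKer (d + 1) (Fib d)) = mmRead (Lc ^ j * Lc) := by rw [pow_succ]
  show mmRead (Lc ^ (j + 1)) (KInv (N := Lc ^ (j + 1)) (d := d)) = mmRead Lc (dec (Lc ^ j) (KInv (N := Lc ^ (j + 1)) (d := d)))
  rw [h]
  exact mmRead_mul_eq_mmRead_dec (Lc ^ j) Lc _

end ReadOut

section FarBricks

variable {d : ℕ}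

/-- [folklore] Weakening a bi-localisation bound: larger constant, smaller rate. -/
theorem biLoc_le_mono {K : MKer (d + 1) (Fib d)} {p q : Fin (d + 1) → ℤ} {C C' δ δ' : ℝ} (h : BiLoc K p q C δ) (hC : 0 ≤ C)
    (hCC : C ≤ C') (hδ : δ' ≤ δ) : BiLoc K p q C' δ' :=
  fun x z a b => bound_mono (h x z a b) hC hCC hδ (add_nonneg (l1_nonneg _) (l1_nonneg _))

/-- [folklore] **PAIR + SWAP ⟹ FAR-SMALL AT ONE CENTRE**: a kernel bi-localised at `(p, q)` AND at `(q, p)` (same constant and rate) is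
bi-localised at `(p, p)` with a constant DECAYING IN `|q − p|` (rate `δ/4`, far rate `δ/2`): `max(a, b) ≥ (a + b)/2` and two triangle
inequalities.  This is how the `(μy)↔(νy′)`-symmetric second-order families acquire the `LocStencil₂` far factor. -/
theorem biLoc_far_of_pair {K : MKer (d + 1) (Fib d)} {p q : Fin (d + 1) → ℤ} {C δ : ℝ} (h₁ : BiLoc K p q C δ) (h₂ : BiLoc K q p C δ)
    (hδ : 0 ≤ δ) : BiLoc K p p (C * Real.exp (-(δ / 2) * l1 (q - p))) (δ / 4) := by
  have hC : 0 ≤ C := h₁.nonneg (Sum.inl 0)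
  intro x z a b
  have e1 := h₁ x z a b
  have e2 := h₂ x z a b
  have key : |K x z a b| ≤ C * Real.exp (-δ * ((l1 (x - p) + l1 (z - q) + (l1 (x - q) + l1 (z - p))) / 2)) := by
    rcases le_total (l1 (x - p) + l1 (z - q)) (l1 (x - q) + l1 (z - p)) with hle | hle
    · refine e2.trans (mul_le_mul_of_nonneg_left (Real.exp_le_exp.2 ?_) hC)
      have := mul_le_mul_of_nonneg_left hle hδ
      nlinarith
    · refine e1.trans (mul_le_mul_of_nonneg_left (Real.exp_le_exp.2 ?_) hC)
      have := mul_le_mul_of_nonneg_left hle hδ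
      nlinarith
  refine key.trans ?_
  rw [mul_assoc, ← Real.exp_add]
  refine mul_le_mul_of_nonneg_left (Real.exp_le_exp.2 ?_) hC
  have t1 : l1 (q - p) ≤ l1 (q - x) + l1 (x - p) := l1_sub_triangle q x p
  have t2 : l1 (q - p) ≤ l1 (q - z) + l1 (z - p) := l1_sub_triangle q z p
  rw [l1_sub_symm q x] at t1
  rw [l1_sub_symm q z] at t2
  have hS : l1 (q - p) + (l1 (x - p) + l1 (z - p)) / 2 ≤ (l1 (x - p) + l1 (z - q) + (l1 (x - q) + l1 (z - p))) := by
    nlinarith [l1_nonneg (x - p), l1_nonneg (z - p), l1_nonneg (x - q), l1_nonneg (z - q)]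
  have := mul_le_mul_of_nonneg_left hS hδ
  nlinarith [this]

end FarBricks

section K3

variable {d : ℕ}

/-- [folklore] **THE SECOND RESPONSE-DERIVATIVE OF A PACKED RESOLVENT.**  For a kernel `K` (read: `𝕄⁻¹`), first response tables
`S`, `M` (so `dM K N S M b = ∂_b 𝕄` along the response, `K2OfK K N S M b = ∂_b(𝕄⁻¹) = −K·∂_b𝕄·K`) and a table `W b b′` (read:
`∂_b∂_{b′}𝕄` along the response), the kernel
`∂_b∂_{b′}(𝕄⁻¹) = −K·∂_b𝕄·∂_{b′}(𝕄⁻¹) − K·∂_{b′}𝕄·∂_b(𝕄⁻¹) − K·∂_b∂_{b′}𝕄·K`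
(differentiate `∂_{b′}(𝕄⁻¹) = −K·∂_{b′}𝕄·K` once more; the two outer-`K` derivatives give the first two terms).  A definition asserting
nothing; manifestly symmetric in `b ↔ b′` when `W` is (`K3OfK_swap`). -/
def K3OfK (K : MKer (d + 1) (Fib d)) (N : ℕ) (S M : Fin (d + 1) → (Fin (d + 1) → ℤ) → MKer (d + 1) (Fib d))
    (W : Fin (d + 1) → (Fin (d + 1) → ℤ) → Fin (d + 1) → (Fin (d + 1) → ℤ) → MKer (d + 1) (Fib d))
    (μ : Fin (d + 1)) (y : Fin (d + 1) → ℤ) (ν : Fin (d + 1)) (y' : Fin (d + 1) → ℤ) : MKer (d + 1) (Fib d) :=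
  fun x z a b =>
    -(comp (comp K (dM K N S M μ y)) (K2OfK K N S M ν y') x z a b) - comp (comp K (dM K N S M ν y')) (K2OfK K N S M μ y) x z a b
      - comp (comp K (W μ y ν y')) K x z a b

/-- [folklore] `K3OfK` is symmetric under `(μ, y) ↔ (ν, y′)` when `W` is. -/
theorem K3OfK_swap (K : MKer (d + 1) (Fib d)) (N : ℕ) (S M : Fin (d + 1) → (Fin (d + 1) → ℤ) → MKer (d + 1) (Fib d))
    {W : Fin (d + 1) → (Fin (d + 1) → ℤ) → Fin (d + 1) → (Fin (d + 1) → ℤ) → MKer (d + 1) (Fib d)}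
    (hW : ∀ μ y ν y', W ν y' μ y = W μ y ν y') (μ : Fin (d + 1)) (y : Fin (d + 1) → ℤ) (ν : Fin (d + 1)) (y' : Fin (d + 1) → ℤ) :
    K3OfK K N S M W ν y' μ y = K3OfK K N S M W μ y ν y' := by
  funext x z a b
  simp only [K3OfK]
  rw [hW μ y ν y']
  ring

/-- [folklore] `|−a − b − c| ≤ |a| + |b| + |c|`. -/
theorem abs_neg_sub_sub_le (a b c : ℝ) : |-a - b - c| ≤ |a| + |b| + |c| := by
  rw [show -a - b - c = -(a + b + c) by ring, abs_neg]
  exact (abs_add_le _ _).trans (add_le_add (abs_add_le _ _) le_rfl)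

/-- [folklore] `K3OfK` bounded from bounds on its three terms (same centre pair and rate). -/
theorem biLoc_K3OfK_of_parts {K : MKer (d + 1) (Fib d)} {N : ℕ} {S M : Fin (d + 1) → (Fin (d + 1) → ℤ) → MKer (d + 1) (Fib d)}
    {W : Fin (d + 1) → (Fin (d + 1) → ℤ) → Fin (d + 1) → (Fin (d + 1) → ℤ) → MKer (d + 1) (Fib d)}
    {μ : Fin (d + 1)} {y : Fin (d + 1) → ℤ} {ν : Fin (d + 1)} {y' : Fin (d + 1) → ℤ} {p q : Fin (d + 1) → ℤ} {C₁ C₂ C₃ δ : ℝ}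
    (hA : BiLoc (comp (comp K (dM K N S M μ y)) (K2OfK K N S M ν y')) p q C₁ δ)
    (hB : BiLoc (comp (comp K (dM K N S M ν y')) (K2OfK K N S M μ y)) p q C₂ δ)
    (hG : BiLoc (comp (comp K (W μ y ν y')) K) p q C₃ δ) : BiLoc (K3OfK K N S M W μ y ν y') p q (C₁ + C₂ + C₃) δ := by
  intro x z a b
  simp only [K3OfK]
  rw [add_mul, add_mul]
  exact (abs_neg_sub_sub_le _ _ _).trans (add_le_add (add_le_add (hA x z a b) (hB x z a b)) (hG x z a b))

variable {N : ℕ} [NeZero N]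

/-- [folklore] **FAR-SMALL LOCALISATION OF `K3OfK` AT THE FIRST COARSE BOND.**  `K` decaying at rate `m`, `S` a local stencil and `M` a
vertex family at rate `m`, and `W b b′` bi-localised at the first bond `N•y` with a constant decaying at rate `m` in `|N•y′ − N•y|` ⟹
`K3OfK … b b′` is bi-localised at `N•y`, rate `m/32`, with a constant decaying at rate `m/32` in `|N•y′ − N•y|`: the two product terms by
`ExpKernelCalculus.biLoc_comp_decays` / `biLoc_comp_biLoc` (the second factor sits at the OTHER bond; `SecondOrderResponse.biLoc_recenter_right`
/ `_left` trades its centre for the far factor), the sandwich term by `SecondOrderResponse.biLoc_sandwich`.  Existential constant (depending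
on `d, C, Cs, CM, Cw, m` only); rates explicit; no optimality claimed. -/
theorem biLoc_K3OfK_far {K : MKer (d + 1) (Fib d)} {C m : ℝ} (hK : Decays K C m) (hC : 0 ≤ C) (hm : 0 < m)
    {S : Fin (d + 1) → (Fin (d + 1) → ℤ) → MKer (d + 1) (Fib d)} {Cs : ℝ} (hS : LocStencil S Cs m)
    {M : Fin (d + 1) → (Fin (d + 1) → ℤ) → MKer (d + 1) (Fib d)} {CM : ℝ} (hM : VertexFamily M N CM m)
    {W : Fin (d + 1) → (Fin (d + 1) → ℤ) → Fin (d + 1) → (Fin (d + 1) → ℤ) → MKer (d + 1) (Fib d)} {Cw : ℝ} (hCw : 0 ≤ Cw)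
    (hW : ∀ (μ : Fin (d + 1)) (y : Fin (d + 1) → ℤ) (ν : Fin (d + 1)) (y' : Fin (d + 1) → ℤ),
      BiLoc (W μ y ν y') ((N : ℤ) • y) ((N : ℤ) • y) (Cw * Real.exp (-m * l1 ((N : ℤ) • y' - (N : ℤ) • y))) m) :
    ∃ C₃ : ℝ, 0 ≤ C₃ ∧ ∀ (μ : Fin (d + 1)) (y : Fin (d + 1) → ℤ) (ν : Fin (d + 1)) (y' : Fin (d + 1) → ℤ),
      BiLoc (K3OfK K N S M W μ y ν y') ((N : ℤ) • y) ((N : ℤ) • y) (C₃ * Real.exp (-(m / 32) * l1 ((N : ℤ) • y' - (N : ℤ) • y)))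
        (m / 32) := by
  have hCs : 0 ≤ Cs := (hS 0 0).nonneg (Sum.inl 0)
  have hCM : 0 ≤ CM := (hM 0 0).nonneg (Sum.inl 0)
  have hcdM : 0 ≤ cdM d C Cs CM m := cdM_nonneg hC hCs hCM hm
  have hcK2 : 0 ≤ cK2 d C Cs CM m := cK2_nonneg hC hCs hCM hm
  have hKm2 : Decays K C (m / 2) := decays_mono hK hC le_rfl (by linarith)
  -- the product term, generic in the two bonds: centred at (N•y, N•y'), far factor from `biLoc_comp_biLoc`
  obtain ⟨CP, hCP0, prod⟩ : ∃ CP : ℝ, 0 ≤ CP ∧ ∀ (μ : Fin (d + 1)) (y : Fin (d + 1) → ℤ) (ν : Fin (d + 1)) (y' : Fin (d + 1) → ℤ),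
      BiLoc (comp (comp K (dM K N S M μ y)) (K2OfK K N S M ν y')) ((N : ℤ) • y) ((N : ℤ) • y')
        (CP * Real.exp (-(m / 16) * l1 ((N : ℤ) • y - (N : ℤ) • y'))) (m / 8) := by
    have hZ1 := Zl_nonneg (D := d + 1) (show 0 < m / 2 - m / 4 by linarith)
    have hZ2 := Zl_nonneg (D := d + 1) (show 0 < m / 16 by positivity)
    refine ⟨(Fintype.card (Fib d) : ℝ) * ((Fintype.card (Fib d) : ℝ) * (C * cdM d C Cs CM m) * Zl (d + 1) (m / 2 - m / 4)
        * cK2 d C Cs CM m) * Zl (d + 1) (m / 16), by positivity, fun μ y ν y' => ?_⟩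
    have hD : BiLoc (dM K N S M μ y) ((N : ℤ) • y) ((N : ℤ) • y) (cdM d C Cs CM m) (m / 2) := vertexFamily_dM hK hC hS hM hm le_rfl μ y
    have h1 := biLoc_comp_decays hKm2 hD (show (0 : ℝ) ≤ m / 4 by positivity) (by linarith)
    have h1' := biLoc_mono h1 (by positivity) (show m / 8 ≤ m / 4 by linarith)
    have h2 : BiLoc (K2OfK K N S M ν y') ((N : ℤ) • y') ((N : ℤ) • y') (cK2 d C Cs CM m) (m / 8) := vertexFamily_K2OfK hK hC hm hS hM ν y'
    have h3 := biLoc_comp_biLoc h1' h2 (show (0 : ℝ) < m / 8 by positivity)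
    rw [show m / 8 / 2 = m / 16 by ring] at h3
    exact h3
  -- the sandwich term, un-negated, weakened to rate m/32 with far rate m/32
  obtain ⟨CS, hCS0, sand⟩ : ∃ CS : ℝ, 0 ≤ CS ∧ ∀ (μ : Fin (d + 1)) (y : Fin (d + 1) → ℤ) (ν : Fin (d + 1)) (y' : Fin (d + 1) → ℤ),
      BiLoc (comp (comp K (W μ y ν y')) K) ((N : ℤ) • y) ((N : ℤ) • y)
        (CS * Real.exp (-(m / 32) * l1 ((N : ℤ) • y' - (N : ℤ) • y))) (m / 32) := by
    have hZ2 := Zl_nonneg (D := d + 1) (show 0 < m / 2 by positivity)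
    have hZ4 := Zl_nonneg (D := d + 1) (show 0 < m / 4 by positivity)
    refine ⟨(Fintype.card (Fib d) : ℝ) * ((Fintype.card (Fib d) : ℝ) * (C * Cw) * Zl (d + 1) (m / 2) * C) * Zl (d + 1) (m / 4),
      by positivity, fun μ y ν y' => ?_⟩
    have h := biLoc_sandwich hK hC hm (hW μ y ν y')
    have h' : BiLoc (comp (comp K (W μ y ν y')) K) ((N : ℤ) • y) ((N : ℤ) • y)
        ((Fintype.card (Fib d) : ℝ) * ((Fintype.card (Fib d) : ℝ) * (C * (Cw * Real.exp (-m * l1 ((N : ℤ) • y' - (N : ℤ) • y))))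
          * Zl (d + 1) (m / 2) * C) * Zl (d + 1) (m / 4)) (m / 4) := by
      intro x z a b
      have hx := h x z a b
      simp only [abs_neg] at hx
      exact hx
    refine biLoc_le_mono h' (by positivity) ?_ (by linarith)
    have hexp : Real.exp (-m * l1 ((N : ℤ) • y' - (N : ℤ) • y)) ≤ Real.exp (-(m / 32) * l1 ((N : ℤ) • y' - (N : ℤ) • y)) :=
      Real.exp_le_exp.2 (by nlinarith [l1_nonneg ((N : ℤ) • y' - (N : ℤ) • y)])
    have e : (Fintype.card (Fib d) : ℝ) * ((Fintype.card (Fib d) : ℝ) * (C * (Cw * Real.exp (-m * l1 ((N : ℤ) • y' - (N : ℤ) • y))))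
          * Zl (d + 1) (m / 2) * C) * Zl (d + 1) (m / 4)
        = (Fintype.card (Fib d) : ℝ) * ((Fintype.card (Fib d) : ℝ) * (C * Cw) * Zl (d + 1) (m / 2) * C) * Zl (d + 1) (m / 4)
          * Real.exp (-m * l1 ((N : ℤ) • y' - (N : ℤ) • y)) := by ring
    rw [e]
    exact mul_le_mul_of_nonneg_left hexp (by positivity)
  refine ⟨CP + CP + CS, by positivity, fun μ y ν y' => ?_⟩
  -- term A : recentre the second leg from N•y' to N•y
  have hA : BiLoc (comp (comp K (dM K N S M μ y)) (K2OfK K N S M ν y')) ((N : ℤ) • y) ((N : ℤ) • y)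
      (CP * Real.exp (-(m / 32) * l1 ((N : ℤ) • y' - (N : ℤ) • y))) (m / 32) := by
    have h' : BiLoc (comp (comp K (dM K N S M μ y)) (K2OfK K N S M ν y')) ((N : ℤ) • y) ((N : ℤ) • y')
        (CP * Real.exp (-(m / 32) * l1 ((N : ℤ) • y' - (N : ℤ) • y)) * Real.exp (-(m / 32) * l1 ((N : ℤ) • y - (N : ℤ) • y')))
        (m / 32) := by
      refine biLoc_le_mono (prod μ y ν y') (by positivity) ?_ (by linarith)
      rw [l1_sub_symm ((N : ℤ) • y') ((N : ℤ) • y), mul_assoc, ← Real.exp_add]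
      exact mul_le_mul_of_nonneg_left (Real.exp_le_exp.2 (by nlinarith [l1_nonneg ((N : ℤ) • y - (N : ℤ) • y')])) hCP0
    exact biLoc_recenter_right h' (by positivity) (by positivity) le_rfl
  -- term B : the swapped product, recentre the first leg from N•y' to N•y
  have hB : BiLoc (comp (comp K (dM K N S M ν y')) (K2OfK K N S M μ y)) ((N : ℤ) • y) ((N : ℤ) • y)
      (CP * Real.exp (-(m / 32) * l1 ((N : ℤ) • y' - (N : ℤ) • y))) (m / 32) := by
    have h' : BiLoc (comp (comp K (dM K N S M ν y')) (K2OfK K N S M μ y)) ((N : ℤ) • y') ((N : ℤ) • y)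
        (CP * Real.exp (-(m / 32) * l1 ((N : ℤ) • y' - (N : ℤ) • y)) * Real.exp (-(m / 32) * l1 ((N : ℤ) • y - (N : ℤ) • y')))
        (m / 32) := by
      refine biLoc_le_mono (prod ν y' μ y) (by positivity) ?_ (by linarith)
      rw [mul_assoc, ← Real.exp_add, l1_sub_symm ((N : ℤ) • y) ((N : ℤ) • y')]
      exact mul_le_mul_of_nonneg_left (Real.exp_le_exp.2 (by nlinarith [l1_nonneg ((N : ℤ) • y' - (N : ℤ) • y)])) hCP0
    exact biLoc_recenter_left h' (by positivity) (by positivity) le_rfl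
  have e : CP * Real.exp (-(m / 32) * l1 ((N : ℤ) • y' - (N : ℤ) • y)) + CP * Real.exp (-(m / 32) * l1 ((N : ℤ) • y' - (N : ℤ) • y))
      + CS * Real.exp (-(m / 32) * l1 ((N : ℤ) • y' - (N : ℤ) • y)) = (CP + CP + CS) * Real.exp (-(m / 32) * l1 ((N : ℤ) • y' - (N : ℤ) • y)) := by
    ring
  rw [← e]
  exact biLoc_K3OfK_of_parts hA hB (sand μ y ν y')

/-- [folklore] **JOINT COARSE COVARIANCE OF `K3OfK`** for a block-covariant kernel, block-covariant first tables and a jointly covariant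
`W`: `K3OfK … μ (y + t) ν (y′ + t) = shiftK (−N•t) (K3OfK … μ y ν y′)` (`SecondOrderResponse.dM_translate` / `K2OfK_translate`,
`ExpKernelCalculus.comp_shiftK`, `BalabanStepJetsSucc.comp_sandwich_shiftK`). -/
theorem K3OfK_translate {K : MKer (d + 1) (Fib d)} (hKs : ∀ t, shiftK (-((N : ℤ) • t)) K = K)
    {S M : Fin (d + 1) → (Fin (d + 1) → ℤ) → MKer (d + 1) (Fib d)}
    (hS : ∀ (κ : Fin (d + 1)) (u t : Fin (d + 1) → ℤ), S κ (u + (N : ℤ) • t) = shiftK (-((N : ℤ) • t)) (S κ u))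
    (hM : ∀ (ρ : Fin (d + 1)) (w t : Fin (d + 1) → ℤ), M ρ (w + t) = shiftK (-((N : ℤ) • t)) (M ρ w))
    {W : Fin (d + 1) → (Fin (d + 1) → ℤ) → Fin (d + 1) → (Fin (d + 1) → ℤ) → MKer (d + 1) (Fib d)}
    (hWt : ∀ (μ : Fin (d + 1)) (y : Fin (d + 1) → ℤ) (ν : Fin (d + 1)) (y' t : Fin (d + 1) → ℤ),
      W μ (y + t) ν (y' + t) = shiftK (-((N : ℤ) • t)) (W μ y ν y'))
    (μ : Fin (d + 1)) (y : Fin (d + 1) → ℤ) (ν : Fin (d + 1)) (y' t : Fin (d + 1) → ℤ) :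
    K3OfK K N S M W μ (y + t) ν (y' + t) = shiftK (-((N : ℤ) • t)) (K3OfK K N S M W μ y ν y') := by
  have hD1 := dM_translate hKs hS hM μ y t
  have hD2 := dM_translate hKs hS hM ν y' t
  have hE1 := K2OfK_translate hKs hS hM μ y t
  have hE2 := K2OfK_translate hKs hS hM ν y' t
  have c1 : comp (comp K (shiftK (-((N : ℤ) • t)) (dM K N S M μ y))) (shiftK (-((N : ℤ) • t)) (K2OfK K N S M ν y'))
      = shiftK (-((N : ℤ) • t)) (comp (comp K (dM K N S M μ y)) (K2OfK K N S M ν y')) := by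
    conv_rhs => rw [← comp_shiftK, ← comp_shiftK, hKs t]
  have c2 : comp (comp K (shiftK (-((N : ℤ) • t)) (dM K N S M ν y'))) (shiftK (-((N : ℤ) • t)) (K2OfK K N S M μ y))
      = shiftK (-((N : ℤ) • t)) (comp (comp K (dM K N S M ν y')) (K2OfK K N S M μ y)) := by
    conv_rhs => rw [← comp_shiftK, ← comp_shiftK, hKs t]
  have c3 := comp_sandwich_shiftK (hKs t) (W μ y ν y')
  funext x z a b
  simp only [K3OfK, shiftK]
  rw [hD1, hD2, hE1, hE2, hWt μ y ν y' t, c1, c2, c3]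
  rfl

end K3

/-! ## §5 The value 4-jet of the `(j+1)`-step system in STEP form: `e4OfW` -/

section E4

variable (d : ℕ) (Lc : ℕ) [NeZero Lc]

/-- WEIGHT of the step-form value 4-jet at composite blocking `Lc^j` (units yardstick `X-an2-39` §4: two value legs more than `wE`):
`wV4 j = (Lc^j)^{4(d+2)}` (`= 1` at `j = 0`).  Provisional ((P6) pins weights last).  A definition asserting nothing. [folklore] -/
def wV4 (j : ℕ) : ℝ := ((Lc : ℝ) ^ j) ^ (4 * (d + 2))

/-- WEIGHT of the second-order averaging border at composite blocking `Lc^j`: `wB2 j = (Lc^j)^{3(d+2)}` (`= 1` at `j = 0`).  Provisional.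
A definition asserting nothing. [folklore] -/
def wB2 (j : ℕ) : ℝ := ((Lc : ℝ) ^ j) ^ (3 * (d + 2))

/-- [folklore] **THE VALUE 4-JET OF THE `(j+1)`-STEP SYSTEM IN STEP FORM.**  With `K_j = KInvStep Lc j` (an4's step-`j` kernel, whose
multiplier block read at blocking `Lc` IS `E2 (j+1)`: `E2_succ_eq`), first response tables `S`, `M` and second response table `W` of the
step-`j` system, the table of second bond-derivatives of the `(j+1)`-step effective-action Hessian along the response:
`e4OfW j S M W b b′ = mmRead Lc (∂_b∂_{b′} K_j) = mmRead Lc (K3OfK K_j Lc S M W b b′)`, indexed by the coarse bonds of the step-`j` system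
(= the fine bonds of the step-`(j+1)` system).  NO power of `Lc` (the `dec` legs of `KInvStep` carry weight one; contrast the PROVISIONAL
reading recorded in the cell file before `E2_succ_eq`).  A definition asserting nothing. -/
def e4OfW (j : ℕ) (S M : Fin (d + 1) → (Fin (d + 1) → ℤ) → MKer (d + 1) (Fib d))
    (W : Fin (d + 1) → (Fin (d + 1) → ℤ) → Fin (d + 1) → (Fin (d + 1) → ℤ) → MKer (d + 1) (Fib d))
    (μ : Fin (d + 1)) (y : Fin (d + 1) → ℤ) (ν : Fin (d + 1)) (y' : Fin (d + 1) → ℤ) : MKer (d + 1) (Fib d) :=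
  mmRead Lc (K3OfK (KInvStep (d := d) Lc j) Lc S M W μ y ν y')

variable {d Lc}

/-- [folklore] `e4OfW` is symmetric under `(μ, y) ↔ (ν, y′)` when `W` is. -/
theorem e4OfW_swap (j : ℕ) (S M : Fin (d + 1) → (Fin (d + 1) → ℤ) → MKer (d + 1) (Fib d))
    {W : Fin (d + 1) → (Fin (d + 1) → ℤ) → Fin (d + 1) → (Fin (d + 1) → ℤ) → MKer (d + 1) (Fib d)}
    (hW : ∀ μ y ν y', W ν y' μ y = W μ y ν y') (μ : Fin (d + 1)) (y : Fin (d + 1) → ℤ) (ν : Fin (d + 1)) (y' : Fin (d + 1) → ℤ) :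
    e4OfW d Lc j S M W ν y' μ y = e4OfW d Lc j S M W μ y ν y' := by
  unfold e4OfW
  rw [K3OfK_swap _ _ _ _ hW]

omit [NeZero Lc] in
/-- [folklore] Rate weakening for vertex families. -/
theorem vertexFamily_mono' {M : Fin (d + 1) → (Fin (d + 1) → ℤ) → MKer (d + 1) (Fib d)} {C δ δ' : ℝ} (h : VertexFamily M Lc C δ)
    (hC : 0 ≤ C) (hδ : δ' ≤ δ) : VertexFamily M Lc C δ' :=
  fun ρ w => biLoc_mono (h ρ w) hC hδ

/-- [folklore] **`e4OfW j S M W` IS A BI-STENCIL FAMILY OF THE `LocStencil₂` SHAPE** (some rate `δ > 0`), for first tables localised at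
some positive rates and a `(μy)↔(νy′)`-SYMMETRIC second table that is a `VertexFamily₂` at some positive rate: symmetry + the pair
certificate give the far-small shape at one bond (`biLoc_far_of_pair`), all rates are harmonised to their minimum, `biLoc_K3OfK_far`
localises `K3OfK`, and `BalabanStepJetsSucc.biLoc_mmRead` reads it at the coarse points (`l1 (u′ − u) ≤ l1 (Lc•u′ − Lc•u)`).
Existential at fixed `Lc`, `j`; no uniformity claimed. -/
theorem locStencil₂_e4OfW (hLc : 1 ≤ Lc) (j : ℕ) {S : Fin (d + 1) → (Fin (d + 1) → ℤ) → MKer (d + 1) (Fib d)}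
    (hS : ∃ Cs δ : ℝ, 0 < δ ∧ LocStencil S Cs δ) {M : Fin (d + 1) → (Fin (d + 1) → ℤ) → MKer (d + 1) (Fib d)}
    (hM : ∃ CM δ : ℝ, 0 < δ ∧ VertexFamily M Lc CM δ)
    {W : Fin (d + 1) → (Fin (d + 1) → ℤ) → Fin (d + 1) → (Fin (d + 1) → ℤ) → MKer (d + 1) (Fib d)}
    (hW : ∃ Cw δ : ℝ, 0 < δ ∧ VertexFamily₂ W Lc Cw δ) (hWs : ∀ μ y ν y', W ν y' μ y = W μ y ν y') :
    ∃ C δ : ℝ, 0 < δ ∧ LocStencil₂ (e4OfW d Lc j S M W) C δ := by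
  obtain ⟨δK, CK, hδK, hCK, hK⟩ := decays_KInvStep (Lc := Lc) (d := d) j
  obtain ⟨Cs, δs, hδs, hS⟩ := hS
  obtain ⟨CM, δM, hδM, hM⟩ := hM
  obtain ⟨Cw, δw, hδw, hW⟩ := hW
  have hCs : 0 ≤ Cs := (hS 0 0).nonneg (Sum.inl 0)
  have hCM : 0 ≤ CM := (hM 0 0).nonneg (Sum.inl 0)
  have hCw : 0 ≤ Cw := (hW 0 0 0 0).nonneg (Sum.inl 0)
  -- the common rate
  obtain ⟨m, hm, hmK, hms, hmM, hmw⟩ : ∃ m : ℝ, 0 < m ∧ m ≤ δK ∧ m ≤ δs ∧ m ≤ δM ∧ m ≤ δw / 4 :=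
    ⟨min (min δK δs) (min δM (δw / 4)), lt_min (lt_min hδK hδs) (lt_min hδM (by positivity)),
      (min_le_left _ _).trans (min_le_left _ _), (min_le_left _ _).trans (min_le_right _ _),
      (min_le_right _ _).trans (min_le_left _ _), (min_le_right _ _).trans (min_le_right _ _)⟩
  have hKm : Decays (KInvStep (d := d) Lc j) CK m := decays_mono hK hCK le_rfl hmK
  have hSm : LocStencil S Cs m := locStencil_mono hS hCs hms
  have hMm : VertexFamily M Lc CM m := vertexFamily_mono' hM hCM hmM
  have hWm : ∀ (μ : Fin (d + 1)) (y : Fin (d + 1) → ℤ) (ν : Fin (d + 1)) (y' : Fin (d + 1) → ℤ),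
      BiLoc (W μ y ν y') ((Lc : ℤ) • y) ((Lc : ℤ) • y) (Cw * Real.exp (-m * l1 ((Lc : ℤ) • y' - (Lc : ℤ) • y))) m := by
    intro μ y ν y'
    have h2 : BiLoc (W μ y ν y') ((Lc : ℤ) • y') ((Lc : ℤ) • y) Cw δw := by
      rw [← hWs μ y ν y']
      exact hW ν y' μ y
    refine biLoc_le_mono (biLoc_far_of_pair (hW μ y ν y') h2 hδw.le) (by positivity) ?_ hmw
    exact mul_le_mul_of_nonneg_left (Real.exp_le_exp.2 (by nlinarith [l1_nonneg ((Lc : ℤ) • y' - (Lc : ℤ) • y)])) hCw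
  obtain ⟨C₃, hC₃, h3⟩ := biLoc_K3OfK_far hKm hCK hm hSm hMm hCw hWm
  refine ⟨C₃, m / 32, by positivity, fun κ u κ' u' => ?_⟩
  have h' : BiLoc (K3OfK (KInvStep (d := d) Lc j) Lc S M W κ u κ' u') ((Lc : ℤ) • u) ((Lc : ℤ) • u)
      (C₃ * Real.exp (-(m / 32) * l1 (u' - u))) (m / 32) := by
    refine biLoc_le_mono (h3 κ u κ' u') (by positivity) ?_ le_rfl
    exact mul_le_mul_of_nonneg_left (Real.exp_le_exp.2 (by nlinarith [l1_sub_le_l1_smul_sub hLc u' u])) hC₃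
  exact biLoc_mmRead hLc h' (by positivity)

/-- [folklore] **COVARIANCE OF `e4OfW`** under ALL translations of the step-`(j+1)` lattice (= coarse translations of the step-`j` system):
block-covariant first tables and a jointly covariant `W` give `e4OfW … μ (y + t) ν (y′ + t) = shiftK (−t) (e4OfW … μ y ν y′)`
(`K3OfK_translate` with an4's `shiftK_KInvStep`, then `BalabanStepJetsSucc.mmRead_shiftK_smul`). -/
theorem e4OfW_translate (j : ℕ) {S M : Fin (d + 1) → (Fin (d + 1) → ℤ) → MKer (d + 1) (Fib d)}
    (hS : ∀ (κ : Fin (d + 1)) (u t : Fin (d + 1) → ℤ), S κ (u + (Lc : ℤ) • t) = shiftK (-((Lc : ℤ) • t)) (S κ u))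
    (hM : ∀ (ρ : Fin (d + 1)) (w t : Fin (d + 1) → ℤ), M ρ (w + t) = shiftK (-((Lc : ℤ) • t)) (M ρ w))
    {W : Fin (d + 1) → (Fin (d + 1) → ℤ) → Fin (d + 1) → (Fin (d + 1) → ℤ) → MKer (d + 1) (Fib d)}
    (hWt : ∀ (μ : Fin (d + 1)) (y : Fin (d + 1) → ℤ) (ν : Fin (d + 1)) (y' t : Fin (d + 1) → ℤ),
      W μ (y + t) ν (y' + t) = shiftK (-((Lc : ℤ) • t)) (W μ y ν y'))
    (μ : Fin (d + 1)) (y : Fin (d + 1) → ℤ) (ν : Fin (d + 1)) (y' t : Fin (d + 1) → ℤ) :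
    e4OfW d Lc j S M W μ (y + t) ν (y' + t) = shiftK (-t) (e4OfW d Lc j S M W μ y ν y') := by
  unfold e4OfW
  rw [K3OfK_translate (fun s => shiftK_KInvStep (Lc := Lc) (d := d) j s) hS hM hWt, mmRead_shiftK_smul]

end E4

/-! ## §6 The recursive bi-stencil family `T2Of` and the instantiated second-order family -/

section T2

/-- [folklore] **THE RECURSIVE SECOND-ORDER STENCIL-TABLE FAMILY** `T2Of j` (the `T₂` argument of `WbalOf`), over the binders `T` (an3's
Wilson two-bond position table, entering through `WilsonBiStencil.wilsonW₂` BY NAME), `vh₂S` (an1's second-order averaging border, node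
12b) and `mixFF` (an1's fine×coarse border):
member `0` = `cE₂ • wilsonW₂ d T + cB • (mfNeg ∘ vh₂S)` (value 4-jet of the Wilson action ⊕ border, the shape of `S0` one order up);
member `j+1` = `(cE₂·wV4 (j+1)) • e4OfW j (Spure j) (M1 j) (WbalOf … T2Of … j) + (cB·wB2 (j+1)) • (mfNeg ∘ vh₂S)` — the value 4-jet of
the `(j+1)`-step system in step form through member `j` of the very family being defined (structural recursion on `j`), ⊕ the same
border at its weight.  Colour constants `cE₂, cB` and weights provisional ((P6)).  A definition asserting nothing. -/
def T2Of (d Lc : ℕ) [NeZero Lc] (cE cVH cΛ cE₂ cB : ℝ) (T : Fin 4 → Fin 4 → Fin 4 → Fin 4 → ℝ)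
    (vh₂S : Fin (d + 1) → (Fin (d + 1) → ℤ) → Fin (d + 1) → (Fin (d + 1) → ℤ) → MKer (d + 1) (Fib d))
    (mixFF : Fin (d + 1) → (Fin (d + 1) → ℤ) → Fin (d + 1) → (Fin (d + 1) → ℤ) → MKer (d + 1) (Fib d)) :
    ℕ → Fin (d + 1) → (Fin (d + 1) → ℤ) → Fin (d + 1) → (Fin (d + 1) → ℤ) → MKer (d + 1) (Fib d)
  | 0 => fun κ u κ' u' => cE₂ • wilsonW₂ d T κ u κ' u' + cB • mfNeg (vh₂S κ u κ' u')
  | j + 1 => fun κ u κ' u' =>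
      (cE₂ * wV4 d Lc (j + 1)) •
          e4OfW d Lc j (Spure d Lc cE cVH cΛ j) (M1 d Lc cΛ j)
            (W2SymOfK (KInvStep (d := d) Lc j) Lc (Spure d Lc cE cVH cΛ j) (M1 d Lc cΛ j)
              (T2Of d Lc cE cVH cΛ cE₂ cB T vh₂S mixFF j) (M2Of d Lc mixFF j)) κ u κ' u'
        + (cB * wB2 d Lc (j + 1)) • mfNeg (vh₂S κ u κ' u')

variable {d : ℕ} {Lc : ℕ} [NeZero Lc]

/-- [folklore] Member `0` of `T2Of`, by `rfl`. -/
@[simp] theorem T2Of_zero (cE cVH cΛ cE₂ cB : ℝ) (T : Fin 4 → Fin 4 → Fin 4 → Fin 4 → ℝ)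
    (vh₂S mixFF : Fin (d + 1) → (Fin (d + 1) → ℤ) → Fin (d + 1) → (Fin (d + 1) → ℤ) → MKer (d + 1) (Fib d)) :
    T2Of d Lc cE cVH cΛ cE₂ cB T vh₂S mixFF 0 = fun κ u κ' u' => cE₂ • wilsonW₂ d T κ u κ' u' + cB • mfNeg (vh₂S κ u κ' u') := rfl

/-- [folklore] Member `j+1` of `T2Of` THROUGH `WbalOf … j`, by `rfl` (`WbalOf` is `W2SymOfK` of the step-`j` data). -/
@[simp] theorem T2Of_succ (cE cVH cΛ cE₂ cB : ℝ) (T : Fin 4 → Fin 4 → Fin 4 → Fin 4 → ℝ)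
    (vh₂S mixFF : Fin (d + 1) → (Fin (d + 1) → ℤ) → Fin (d + 1) → (Fin (d + 1) → ℤ) → MKer (d + 1) (Fib d)) (j : ℕ) :
    T2Of d Lc cE cVH cΛ cE₂ cB T vh₂S mixFF (j + 1) = fun κ u κ' u' =>
      (cE₂ * wV4 d Lc (j + 1)) •
          e4OfW d Lc j (Spure d Lc cE cVH cΛ j) (M1 d Lc cΛ j)
            (WbalOf d Lc cE cVH cΛ (T2Of d Lc cE cVH cΛ cE₂ cB T vh₂S mixFF) mixFF j) κ u κ' u'
        + (cB * wB2 d Lc (j + 1)) • mfNeg (vh₂S κ u κ' u') := rfl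

omit [NeZero Lc] in
/-- [folklore] Scalar multiple of a `LocStencil₂` family (constant `|c|·C`). -/
theorem locStencil₂_smul' (c : ℝ) {S₂ : Fin (d + 1) → (Fin (d + 1) → ℤ) → Fin (d + 1) → (Fin (d + 1) → ℤ) → MKer (d + 1) (Fib d)}
    {C δ : ℝ} (h : LocStencil₂ S₂ C δ) : LocStencil₂ (fun κ u κ' u' => c • S₂ κ u κ' u') (|c| * C) δ := by
  intro κ u κ' u'
  show BiLoc (c • S₂ κ u κ' u') u u (|c| * C * Real.exp (-δ * l1 (u' - u))) δ
  rw [mul_assoc]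
  exact biLoc_smul c (h κ u κ' u')

omit [NeZero Lc] in
/-- [folklore] Sum of two `LocStencil₂` families at a common rate. -/
theorem locStencil₂_add' {A B : Fin (d + 1) → (Fin (d + 1) → ℤ) → Fin (d + 1) → (Fin (d + 1) → ℤ) → MKer (d + 1) (Fib d)}
    {C₁ C₂ δ : ℝ} (hA : LocStencil₂ A C₁ δ) (hB : LocStencil₂ B C₂ δ) :
    LocStencil₂ (fun κ u κ' u' => A κ u κ' u' + B κ u κ' u') (C₁ + C₂) δ := by
  intro κ u κ' u'
  show BiLoc (A κ u κ' u' + B κ u κ' u') u u ((C₁ + C₂) * Real.exp (-δ * l1 (u' - u))) δ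
  rw [add_mul]
  exact KernelWard.biLoc_add (hA κ u κ' u') (hB κ u κ' u')

omit [NeZero Lc] in
/-- [folklore] `mfNeg` member by member preserves the `LocStencil₂` shape (`StepJetData.biLoc_mfNeg`). -/
theorem locStencil₂_mfNeg {B : Fin (d + 1) → (Fin (d + 1) → ℤ) → Fin (d + 1) → (Fin (d + 1) → ℤ) → MKer (d + 1) (Fib d)}
    {C δ : ℝ} (h : LocStencil₂ B C δ) : LocStencil₂ (fun κ u κ' u' => mfNeg (B κ u κ' u')) C δ :=
  fun κ u κ' u' => biLoc_mfNeg (h κ u κ' u')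

/-- [folklore] **EVERY MEMBER OF `T2Of` IS A `LocStencil₂` FAMILY** (some rate `δ > 0`), by induction on `j`: member `0` from an3's
`biLoc_wilsonW₂` and the border hypothesis `hB`; member `j+1` from member `j` through `SecondOrderResponse.vertexFamily₂_W2SymOfK'`
(the second-order family of the step-`j` system), `WbalOf_swap` and `locStencil₂_e4OfW`, ⊕ the border.  Existential at fixed `Lc`, `j`. -/
theorem T2Of_loc (hLc : 1 ≤ Lc) (cE cVH cΛ cE₂ cB : ℝ) (T : Fin 4 → Fin 4 → Fin 4 → Fin 4 → ℝ)
    {vh₂S : Fin (d + 1) → (Fin (d + 1) → ℤ) → Fin (d + 1) → (Fin (d + 1) → ℤ) → MKer (d + 1) (Fib d)}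
    (hB : ∃ C δ : ℝ, 0 < δ ∧ LocStencil₂ vh₂S C δ)
    {mixFF : Fin (d + 1) → (Fin (d + 1) → ℤ) → Fin (d + 1) → (Fin (d + 1) → ℤ) → MKer (d + 1) (Fib d)}
    (hmix : ∃ C δ : ℝ, 0 < δ ∧ LocStencilFM Lc mixFF C δ) :
    ∀ j : ℕ, ∃ C δ : ℝ, 0 < δ ∧ LocStencil₂ (T2Of d Lc cE cVH cΛ cE₂ cB T vh₂S mixFF j) C δ
  | 0 => by
    obtain ⟨CB, δB, hδB, hBl⟩ := hB
    have hWil : LocStencil₂ (wilsonW₂ d T) (wBound₂ d T * Real.exp (8 * δB)) δB := fun κ u κ' u' => biLoc_wilsonW₂ T hδB.le κ u κ' u'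
    rw [T2Of_zero]
    exact ⟨_, δB, hδB, locStencil₂_add' (locStencil₂_smul' cE₂ hWil) (locStencil₂_smul' cB (locStencil₂_mfNeg hBl))⟩
  | j + 1 => by
    obtain ⟨C₂, δ₂, hδ₂, hT⟩ := T2Of_loc hLc cE cVH cΛ cE₂ cB T hB hmix j
    obtain ⟨CB, δB, hδB, hBl⟩ := hB
    obtain ⟨Cs, δs, hδs, hS⟩ := locStencil_Spure (d := d) (Lc := Lc) hLc cE cVH cΛ j
    obtain ⟨CM₂, δ₃, hδ₃, hM₂⟩ := hmix
    have hWv : ∃ Cw δw : ℝ, 0 < δw ∧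
        VertexFamily₂ (WbalOf d Lc cE cVH cΛ (T2Of d Lc cE cVH cΛ cE₂ cB T vh₂S mixFF) mixFF j) Lc Cw δw :=
      vertexFamily₂_W2SymOfK' (decays_KInvStep (Lc := Lc) (d := d) j) hS hδs (vertexFamily_M1 hLc cΛ j zero_le_one) one_pos
        hT hδ₂ (locStencilFM_M2Of hM₂ j) hδ₃
    obtain ⟨C4, δ4, hδ4, h4⟩ := locStencil₂_e4OfW (d := d) (Lc := Lc) hLc j ⟨Cs, δs, hδs, hS⟩
      ⟨_, 1, one_pos, vertexFamily_M1 hLc cΛ j zero_le_one⟩ hWv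
      (WbalOf_swap cE cVH cΛ (T2Of d Lc cE cVH cΛ cE₂ cB T vh₂S mixFF) mixFF j)
    have hm : 0 < min δ4 δB := lt_min hδ4 hδB
    rw [T2Of_succ]
    exact ⟨_, _, hm, locStencil₂_add' (locStencil₂_smul' _ (h4.mono (min_le_left δ4 δB)))
      (locStencil₂_smul' _ (locStencil₂_mfNeg (hBl.mono (min_le_right δ4 δB))))⟩

/-- [folklore] **JOINT BLOCK COVARIANCE OF EVERY MEMBER OF `T2Of`** (the `hT₂t` hypothesis of `WbalOf_translate` /
`JsBalW2Of_W_translate`, DISCHARGED for this family), by induction on `j`: member `0` from an3's `wilsonW₂_translate` and the border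
hypothesis `hBt`; member `j+1` from member `j` through `SecondOrderResponse.W2SymOfK_translate` and `e4OfW_translate` (at the block
translation `Lc•t` of the step-`(j+1)` lattice), ⊕ the border (`StepJetData.mfNeg_shiftK`). -/
theorem T2Of_translate (hLc : 1 ≤ Lc) (cE cVH cΛ cE₂ cB : ℝ) (T : Fin 4 → Fin 4 → Fin 4 → Fin 4 → ℝ)
    {vh₂S : Fin (d + 1) → (Fin (d + 1) → ℤ) → Fin (d + 1) → (Fin (d + 1) → ℤ) → MKer (d + 1) (Fib d)}
    (hBt : ∀ (κ : Fin (d + 1)) (u : Fin (d + 1) → ℤ) (κ' : Fin (d + 1)) (u' t : Fin (d + 1) → ℤ),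
      vh₂S κ (u + (Lc : ℤ) • t) κ' (u' + (Lc : ℤ) • t) = shiftK (-((Lc : ℤ) • t)) (vh₂S κ u κ' u'))
    {mixFF : Fin (d + 1) → (Fin (d + 1) → ℤ) → Fin (d + 1) → (Fin (d + 1) → ℤ) → MKer (d + 1) (Fib d)}
    (hmixt : ∀ (κ : Fin (d + 1)) (u : Fin (d + 1) → ℤ) (ρ : Fin (d + 1)) (w t : Fin (d + 1) → ℤ),
      mixFF κ (u + (Lc : ℤ) • t) ρ (w + t) = shiftK (-((Lc : ℤ) • t)) (mixFF κ u ρ w)) :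
    ∀ (j : ℕ) (κ : Fin (d + 1)) (u : Fin (d + 1) → ℤ) (κ' : Fin (d + 1)) (u' t : Fin (d + 1) → ℤ),
      T2Of d Lc cE cVH cΛ cE₂ cB T vh₂S mixFF j κ (u + (Lc : ℤ) • t) κ' (u' + (Lc : ℤ) • t)
        = shiftK (-((Lc : ℤ) • t)) (T2Of d Lc cE cVH cΛ cE₂ cB T vh₂S mixFF j κ u κ' u')
  | 0, κ, u, κ', u', t => by
    show cE₂ • wilsonW₂ d T κ (u + (Lc : ℤ) • t) κ' (u' + (Lc : ℤ) • t) + cB • mfNeg (vh₂S κ (u + (Lc : ℤ) • t) κ' (u' + (Lc : ℤ) • t))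
      = shiftK (-((Lc : ℤ) • t)) (cE₂ • wilsonW₂ d T κ u κ' u' + cB • mfNeg (vh₂S κ u κ' u'))
    rw [wilsonW₂_translate, hBt, mfNeg_shiftK]
    rfl
  | j + 1, κ, u, κ', u', t => by
    have IH := T2Of_translate hLc cE cVH cΛ cE₂ cB T hBt hmixt j
    have hWt : ∀ (μ : Fin (d + 1)) (y : Fin (d + 1) → ℤ) (ν : Fin (d + 1)) (y' s : Fin (d + 1) → ℤ),
        W2SymOfK (KInvStep (d := d) Lc j) Lc (Spure d Lc cE cVH cΛ j) (M1 d Lc cΛ j) (T2Of d Lc cE cVH cΛ cE₂ cB T vh₂S mixFF j)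
            (M2Of d Lc mixFF j) μ (y + s) ν (y' + s)
          = shiftK (-((Lc : ℤ) • s)) (W2SymOfK (KInvStep (d := d) Lc j) Lc (Spure d Lc cE cVH cΛ j) (M1 d Lc cΛ j)
              (T2Of d Lc cE cVH cΛ cE₂ cB T vh₂S mixFF j) (M2Of d Lc mixFF j) μ y ν y') :=
      fun μ y ν y' s => W2SymOfK_translate (N := Lc) (fun s' => shiftK_KInvStep (Lc := Lc) (d := d) j s')
        (Spure_translate hLc cE cVH cΛ j) (M1_translate (Lc := Lc) cΛ j) IH (M2Of_translate (Lc := Lc) hmixt j) μ y ν y' s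
    show (cE₂ * wV4 d Lc (j + 1)) •
          e4OfW d Lc j (Spure d Lc cE cVH cΛ j) (M1 d Lc cΛ j)
            (W2SymOfK (KInvStep (d := d) Lc j) Lc (Spure d Lc cE cVH cΛ j) (M1 d Lc cΛ j)
              (T2Of d Lc cE cVH cΛ cE₂ cB T vh₂S mixFF j) (M2Of d Lc mixFF j)) κ (u + (Lc : ℤ) • t) κ' (u' + (Lc : ℤ) • t)
        + (cB * wB2 d Lc (j + 1)) • mfNeg (vh₂S κ (u + (Lc : ℤ) • t) κ' (u' + (Lc : ℤ) • t))
      = shiftK (-((Lc : ℤ) • t)) ((cE₂ * wV4 d Lc (j + 1)) •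
          e4OfW d Lc j (Spure d Lc cE cVH cΛ j) (M1 d Lc cΛ j)
            (W2SymOfK (KInvStep (d := d) Lc j) Lc (Spure d Lc cE cVH cΛ j) (M1 d Lc cΛ j)
              (T2Of d Lc cE cVH cΛ cE₂ cB T vh₂S mixFF j) (M2Of d Lc mixFF j)) κ u κ' u'
        + (cB * wB2 d Lc (j + 1)) • mfNeg (vh₂S κ u κ' u'))
    rw [e4OfW_translate j (Spure_translate hLc cE cVH cΛ j) (M1_translate (Lc := Lc) cΛ j) hWt, hBt, mfNeg_shiftK]
    rfl

/-! ### §6b The instantiated second-order family and its sockets -/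

section Inst

variable (hLc : 1 ≤ Lc) (cE cVH cΛ cE₂ cB : ℝ) (T : Fin 4 → Fin 4 → Fin 4 → Fin 4 → ℝ)
    {vh₂S : Fin (d + 1) → (Fin (d + 1) → ℤ) → Fin (d + 1) → (Fin (d + 1) → ℤ) → MKer (d + 1) (Fib d)}
    (hB : ∃ C δ : ℝ, 0 < δ ∧ LocStencil₂ vh₂S C δ)
    {mixFF : Fin (d + 1) → (Fin (d + 1) → ℤ) → Fin (d + 1) → (Fin (d + 1) → ℤ) → MKer (d + 1) (Fib d)}
    (hmix : ∃ C δ : ℝ, 0 < δ ∧ LocStencilFM Lc mixFF C δ)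

/-- [folklore] **THE SECOND-ORDER FAMILY OF THE BACKGROUND-FIELD STEP WITH ITS RECURSIVE TABLES**: `WbalT2Of … j := WbalOf … (T2Of …) … j`
— three binders left (`T` by value; `vh₂S`, `mixFF` with their localisation hypotheses), all other tables BY NAME.  A definition. -/
def WbalT2Of (j : ℕ) :
    Fin (d + 1) → (Fin (d + 1) → ℤ) → Fin (d + 1) → (Fin (d + 1) → ℤ) → MKer (d + 1) (Fib d) :=
  WbalOf d Lc cE cVH cΛ (T2Of d Lc cE cVH cΛ cE₂ cB T vh₂S mixFF) mixFF j

/-- [folklore] **THE DRESSED JET-DATA FAMILY WITH RECURSIVE SECOND-ORDER TABLES** — `JsBalW2Of` at `T₂ := T2Of …`, its `hT₂`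
hypothesis DISCHARGED by `T2Of_loc`. -/
def JsBalT2Of : ℕ → JetData d Lc :=
  JsBalW2Of hLc cE cVH cΛ (T2Of_loc hLc cE cVH cΛ cE₂ cB T hB hmix) hmix

/-- [folklore] `JsBalT2Of` is `JsBalW2Of` at the recursive tables, by `rfl`. -/
theorem JsBalT2Of_eq :
    JsBalT2Of hLc cE cVH cΛ cE₂ cB T hB hmix = JsBalW2Of hLc cE cVH cΛ (T2Of_loc hLc cE cVH cΛ cE₂ cB T hB hmix) hmix := rfl

/-- [folklore] **(Wt) FOR THE INSTANTIATED FAMILY WITH RECURSIVE TABLES** — only the two BORDER covariance hypotheses remain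
(`T2Of_translate` discharges `hT₂t`). -/
theorem JsBalT2Of_W_translate
    (hBt : ∀ (κ : Fin (d + 1)) (u : Fin (d + 1) → ℤ) (κ' : Fin (d + 1)) (u' t : Fin (d + 1) → ℤ),
      vh₂S κ (u + (Lc : ℤ) • t) κ' (u' + (Lc : ℤ) • t) = shiftK (-((Lc : ℤ) • t)) (vh₂S κ u κ' u'))
    (hmixt : ∀ (κ : Fin (d + 1)) (u : Fin (d + 1) → ℤ) (ρ : Fin (d + 1)) (w t : Fin (d + 1) → ℤ),
      mixFF κ (u + (Lc : ℤ) • t) ρ (w + t) = shiftK (-((Lc : ℤ) • t)) (mixFF κ u ρ w))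
    (j : ℕ) (μ : Fin (d + 1)) (y : Fin (d + 1) → ℤ) (ν : Fin (d + 1)) (y' t : Fin (d + 1) → ℤ) :
    (JsBalT2Of hLc cE cVH cΛ cE₂ cB T hB hmix j).W μ (y + t) ν (y' + t)
      = shiftK (-((Lc : ℤ) • t)) ((JsBalT2Of hLc cE cVH cΛ cE₂ cB T hB hmix j).W μ y ν y') :=
  JsBalW2Of_W_translate hLc cE cVH cΛ _ hmix (T2Of_translate hLc cE cVH cΛ cE₂ cB T hBt hmixt) hmixt j μ y ν y' t

/-- [folklore] **(St♭) FOR THE INSTANTIATED FAMILY WITH RECURSIVE TABLES** (`JsBalW2Of_S_translate`, BY NAME). -/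
theorem JsBalT2Of_S_translate (j : ℕ) (κ' : Fin (d + 1)) (u t : Fin (d + 1) → ℤ) :
    (JsBalT2Of hLc cE cVH cΛ cE₂ cB T hB hmix j).S κ' (u + (Lc : ℤ) • t)
      = shiftK (-((Lc : ℤ) • t)) ((JsBalT2Of hLc cE cVH cΛ cE₂ cB T hB hmix j).S κ' u) :=
  JsBalW2Of_S_translate hLc cE cVH cΛ _ hmix j κ' u t

end Inst

section WallT2

variable {Lc : ℕ} [NeZero Lc] (hLc : 1 ≤ Lc) (cE cVH cΛ cE₂ cB : ℝ) (T : Fin 4 → Fin 4 → Fin 4 → Fin 4 → ℝ)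
    {vh₂S : Fin (3 + 1) → (Fin (3 + 1) → ℤ) → Fin (3 + 1) → (Fin (3 + 1) → ℤ) → MKer (3 + 1) (Fib 3)}
    (hB : ∃ C δ : ℝ, 0 < δ ∧ LocStencil₂ vh₂S C δ)
    {mixFF : Fin (3 + 1) → (Fin (3 + 1) → ℤ) → Fin (3 + 1) → (Fin (3 + 1) → ℤ) → MKer (3 + 1) (Fib 3)}
    (hmix : ∃ C δ : ℝ, 0 < δ ∧ LocStencilFM Lc mixFF C δ)

/-- [folklore] **THE WALL'S FAMILY WITH RECURSIVE SECOND-ORDER TABLES, MEMBER BY MEMBER** (`d = 3`; `TbalOf_JsBalW2Of` BY NAME): the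
object `OneStepKernelFamily.D1Drift Lc (JsBalT2Of …) N μ ν` reads, with second-order family `WbalT2Of … j`. -/
theorem TbalOf_JsBalT2Of (j : ℕ) :
    TbalOf Lc (JsBalT2Of hLc cE cVH cΛ cE₂ cB T hB hmix) j
      = hessKer (axDressK Lc (KInvStep (d := 3) Lc j))
          (axVertexOfK (KInvStep (d := 3) Lc j) Lc
            (JsBal0Of hLc cE cVH cΛ (WbalT2Of (Lc := Lc) cE cVH cΛ cE₂ cB T (vh₂S := vh₂S) (mixFF := mixFF))
              (CwOf hLc cE cVH cΛ (T2Of_loc hLc cE cVH cΛ cE₂ cB T hB hmix) hmix)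
              (δwOf hLc cE cVH cΛ (T2Of_loc hLc cE cVH cΛ cE₂ cB T hB hmix) hmix)
              (δwOf_pos hLc cE cVH cΛ (T2Of_loc hLc cE cVH cΛ cE₂ cB T hB hmix) hmix)
              (WbalOf_loc₂ hLc cE cVH cΛ (T2Of_loc hLc cE cVH cΛ cE₂ cB T hB hmix) hmix) j).S)
          (WbalT2Of (Lc := Lc) cE cVH cΛ cE₂ cB T (vh₂S := vh₂S) (mixFF := mixFF) j) :=
  TbalOf_JsBalW2Of hLc cE cVH cΛ _ hmix j

end WallT2

end T2

end Literature.MathematicalPhysics.QuantumFieldTheory.Balaban1983to89.Beta.BalabanStepW2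

end
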